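import Literature.Computability.QuantumComplexity.ForrelationThm25Reduction
import Literature.Computability.Complexity.ListFoldChecks
import HarnessLib

/-!
# Aaronson–Ambainis Theorem 25: the instance map `thm25Instance` on codes is in `FP` (discharge)

Topic `Literature/Computability/QuantumComplexity`; sibling of `ForrelationThm25Instance.lean`, whose
residual named fact `AaronsonAmbainis2018_thm25_encodeFP` — the instance map `thm25Instance` of
S. Aaronson, A. Ambainis, *Forrelation*, SIAM J. Comput. 47 (2018) = arXiv:1411.5729, §6, Thm. 25
(QSIM over `{H, CCSIGN}` `→` explicit `k`-fold FORRELATION: compress the touched wires, add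
`n_c mod 2` idle wires, transcribe the circuit gate by gate with the label-swapping wire
bookkeeping of the printed proof, parity repair), read on codes
`QSimInstance.encode (n, Q) ↦ KForrelationInstance.encode (thm25Instance (n, Q))`, is computed by
an `FP` string function — is discharged here: **`AaronsonAmbainis2018_thm25_encodeFP_holds`**.
(Theorem 25 itself is already discharged through the sign basis, `AaronsonAmbainis2018_thm25_holds`
of `ForrelationThm25Reduction.lean`; this file closes the remaining named fact of the
`thm25Instance` decomposition — a second proof of Theorem 25 is then
`AaronsonAmbainis2018_thm25_of_encodeFP AaronsonAmbainis2018_thm25_encodeFP_holds`, not restated.)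

No machine is programmed: the function `Thm25Enc.encFn` is assembled in the tree's algebra of
polynomial-time string functions — folds of an `FP` step over the items of a coded list
(`Brick.foldFn`, `ListFoldBricks.lean`, with the growth discipline `FoldGrowth`), the counted fold
`Brick.foldLoop` (`FoldBricks.lean`), records and projections (`BrickAlgebra.lean`), branching
`iteFn`, fan-out, numerals (`Brick.addFn`, `ltFn`, `parityFn`, `lenBinF`), `List.tail`, constants,
composition — on top of the string functions of `ForrelationThm25Reduction.lean` (`Thm25Red.allWiresFn`,
`countFn`, `psiFn`, `newWires`).

## The pipeline (`Thm25Enc.encFn`, value `encFn_encode`)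

On `z = ⟨bin n, encList (gate codes)⟩` (`QSimInstance.encode`; a gate code is
`0 :: ⟨bin sym, ⟨1ʳ, encList (wire numerals)⟩⟩`, an oracle code starts with `1`):
* `okFn`: every code starts with `0` (oracle-freeness; otherwise the code `0101` of the empty
  instance is returned, as `thm25Instance` prescribes);
* `dFn`: the coded list `D` of the DISTINCT wire numerals (`dedupFn`, a fold with string-equality
  membership), so that `n_c = |D|` (`card_touchedWires_eq`) and the rank of a touched wire `w` in
  the increasing enumeration of the touched wires (`rankIn`, used by `compress`) is
  `ψ_D(w) = #{d ∈ D : d < w}` (`rankIn_val_eq_psi`; `Thm25Red.psiFn`);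
* `cmpBodyFn`: the gate codes with every wire replaced by its rank = the gate codes of
  `liftCircuitBy (n_c mod 2) (compress Q)` (`cmpBodyFn_encode`);
* `hCountFn`, `hparFn`: the parity of the number `h` of Hadamard gates; `npFn`: `bin n'`,
  `n' = n_c + (n_c mod 2)`; `padFn`: the codes of `hOnAllWires n'` (one `H` per logical wire, the
  parity repair), by a counted fold over `j < n' ≤ |z| + 1` (`padFn_encode`);
* `accFn`: the MAIN FOLD over the codes of `extGates = lifted compressed gates ++ padding (h odd)`
  with state `⟨table, ⟨bin dum, out⟩⟩` (`MSt.code`): the wire bookkeeping `σ` (`WireConfig`) is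
  held as the chronological table of bindings "logical qubit `a` ↦ physical wire" — a Hadamard
  gate on `a` looks up `pos a` (`lookupFn`, last binding wins, default `a`), prints the three gadget
  codes on `(pos a, dum)` and a separator, appends the binding `a ↦ dum` and makes `pos a` the new
  dummy; a `CCSIGN` prints separator, phase code, separator, separator (`mainStep`,
  `mainStep_encode`; model `mstep`, `foldl_mainStep`; the model prints the coded shapes of
  `forrBuildD`, `foldl_mstep_out`, through the invariant `MSt.Rel`);
* `outFn` (blocks, final separator(s)), `kFn` (`bin k` from the tally of the items), `nFn`
  (`bin (n' + 1)`), `mainOutFn = ⟨bin N, ⟨bin k, circuits⟩⟩`.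
Growth bookkeeping: every fold step is total with `|step ⟨u, ⟨a, acc⟩⟩| ≤ |acc| + 4|a| + c(|u| + 1)`
(the looked-up positions and the dummy numeral are clipped to `|u| + 1` symbols, a no-op on genuine
data, `foldGrowth_mainStep`).

## References

* S. Aaronson, A. Ambainis, *Forrelation: a problem that optimally separates quantum from
  classical computing*, SIAM J. Comput. 47 (2018) 982–1038; arXiv:1411.5729, §6, Thm. 25 and its
  proof (pp. 26–27: "polynomial-time reducible"; the gadget; "swapping the labels … whenever the
  gadget is applied"; `k = O(m)`).
* S. Arora, B. Barak, *Computational Complexity: A Modern Approach*, CUP 2009, §0.1 (codes of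
  pairs and lists), §1.3 (polynomial time is closed under composition and bounded loops), §6.1
  (descriptions of circuits).
-/

noncomputable section

namespace Literature.Computability.QuantumComplexity

open _root_.Computability Complexity Cryptography Brick Thm25Red

namespace Thm25Enc

variable {n N : ℕ}

/-! ### Generic bricks: de-duplication, table lookup -/

/-- The membership test of the de-duplication step on `⟨u, ⟨a, seen⟩⟩`: `[a ∈ items of seen]`
(string equality, `anyFn eqPairFn`). [folklore] -/
def dedupCond : List Bool → List Bool := anyFn eqPairFn ∘ fanoutFn (nthF 1) (sndPow 1)

/-- Step of the de-duplication fold on `⟨u, ⟨a, seen⟩⟩`: keep `seen` if `a` is one of its items,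
else prepend `a`. [folklore] -/
def dedupStep : List Bool → List Bool := iteFn dedupCond (sndPow 1) (fanoutFn (nthF 1) (sndPow 1))

/-- `dedupCond` is one-bit. [folklore] -/
theorem oneBit_dedupCond : OneBit dedupCond := (oneBit_anyFn oneBit_eqPairFn).comp _

/-- `dedupStep ∈ FP`. [folklore] -/
theorem dedupStep_mem_FP : dedupStep ∈ FP :=
  iteFn_mem_FP (comp_mem_FP (anyFn_mem_FP eqPairFn_mem_FP oneBit_eqPairFn) (fanoutFn_mem_FP (nthF_mem_FP 1) (sndPow_mem_FP 1)))
    (sndPow_mem_FP 1) (fanoutFn_mem_FP (nthF_mem_FP 1) (sndPow_mem_FP 1))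

/-- `dedupStep` on every input: an honest branch. [folklore] -/
theorem dedupStep_eq (v : List Bool) :
    dedupStep v = if dedupCond v = [true] then sndPow 1 v else boolPair (nthF 1 v) (sndPow 1 v) := by
  rw [dedupStep, iteFn_of_oneBit oneBit_dedupCond]
  split_ifs <;> simp

/-- Growth of the de-duplication step: `FoldGrowth 2`. [folklore] -/
theorem foldGrowth_dedupStep : FoldGrowth 2 dedupStep := fun v => by
  have h3 : sndPow 1 v = sndF (sndF v) := rfl
  have h4 : nthF 1 v = fstF (sndF v) := rfl
  rw [dedupStep_eq]
  split_ifs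
  · rw [h3]; omega
  · rw [length_boolPair, h3, h4]; omega

/-- The list-level model of the de-duplication fold: scan `l`, prepending every item not seen
before. [folklore] -/
def dedupModel {α : Type*} [DecidableEq α] (l : List α) (seen : List α) : List α :=
  l.foldl (fun seen a => if a ∈ seen then seen else a :: seen) seen

/-- `dedupModel` of a cons. [folklore] -/
theorem dedupModel_cons {α : Type*} [DecidableEq α] (a : α) (l seen : List α) :
    dedupModel (a :: l) seen = dedupModel l (if a ∈ seen then seen else a :: seen) := rfl

/-- Membership in the de-duplicated list. [folklore] -/
theorem mem_dedupModel_iff {α : Type*} [DecidableEq α] : ∀ (l seen : List α) (x : α),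
    x ∈ dedupModel l seen ↔ x ∈ l ∨ x ∈ seen
  | [], seen, x => by simp [dedupModel]
  | a :: l, seen, x => by
    rw [dedupModel_cons, mem_dedupModel_iff l]
    split_ifs with h
    · constructor
      · rintro (hx | hx)
        · exact Or.inl (List.mem_cons_of_mem a hx)
        · exact Or.inr hx
      · rintro (hx | hx)
        · rcases List.mem_cons.1 hx with rfl | hx
          · exact Or.inr h
          · exact Or.inl hx
        · exact Or.inr hx
    · simp only [List.mem_cons]
      tauto

/-- The de-duplicated list has no duplicates (from a duplicate-free `seen`). [folklore] -/
theorem nodup_dedupModel {α : Type*} [DecidableEq α] : ∀ (l seen : List α), seen.Nodup → (dedupModel l seen).Nodup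
  | [], seen, h => h
  | a :: l, seen, h => by
    rw [dedupModel_cons]
    split_ifs with ha
    · exact nodup_dedupModel l seen h
    · exact nodup_dedupModel l (a :: seen) (List.nodup_cons.2 ⟨ha, h⟩)

/-- The model commutes with an injective map. [folklore] -/
theorem dedupModel_map {α β : Type*} [DecidableEq α] [DecidableEq β] {f : α → β} (hf : Function.Injective f) :
    ∀ (l seen : List α), dedupModel (l.map f) (seen.map f) = (dedupModel l seen).map f
  | [], seen => rfl
  | a :: l, seen => by
    rw [List.map_cons, dedupModel_cons, dedupModel_cons]
    by_cases h : a ∈ seen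
    · rw [if_pos ((List.mem_map_of_injective hf).2 h), if_pos h]
      exact dedupModel_map hf l seen
    · rw [if_neg (fun h' => h ((List.mem_map_of_injective hf).1 h')), if_neg h, ← List.map_cons]
      exact dedupModel_map hf l (a :: seen)

/-- `dedupStep` on a step record with a coded `seen` list. [folklore] -/
theorem dedupStep_apply (u a : List Bool) (seen : List (List Bool)) :
    dedupStep (boolPair u (boolPair a (encList seen))) = encList (dedupModel [a] seen) := by
  have hc : dedupCond (boolPair u (boolPair a (encList seen))) = [decide (a ∈ seen)] := by
    simp only [dedupCond, Function.comp_apply, fanoutFn_apply, nthF_succ_boolPair, nthF_zero_boolPair, sndPow_succ_boolPair,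
      sndPow_zero, sndF_boolPair]
    rw [anyFn_boolPair oneBit_eqPairFn, decNil_encList]
    congr 1
    simp only [eqPairFn_boolPair_eq_true]
    exact decide_eq_decide.mpr ⟨fun ⟨b, hb, e⟩ => e ▸ hb, fun h => ⟨a, h, rfl⟩⟩
  rw [dedupStep_eq, hc, dedupModel, List.foldl_cons, List.foldl_nil]
  by_cases h : a ∈ seen
  · rw [if_pos (by simp [h]), if_pos h]; simp [sndPow]
  · rw [if_neg (by simp [h]), if_neg h, encList_cons]; simp [sndPow, nthF]

/-- **`dedupFn ⟨x, encList l⟩ = encList (dedupModel l [])`**: the items of a coded list without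
repetitions (most recent first). [cite: AroraBarak2009, §1.3 (bounded loops)] -/
def dedupFn : List Bool → List Bool := foldFn dedupStep (fun _ => [])

/-- `dedupFn ∈ FP`. [cite: AroraBarak2009, §1.3] -/
theorem dedupFn_mem_FP : dedupFn ∈ FP := foldFn_mem_FP dedupStep_mem_FP (const_mem_FP _) foldGrowth_dedupStep

/-- The de-duplication fold from a coded `seen` list. [folklore] -/
theorem foldl_dedupStep (w : List Bool) : ∀ (l seen : List (List Bool)),
    l.foldl (fun acc a => dedupStep (boolPair w (boolPair a acc))) (encList seen) = encList (dedupModel l seen)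
  | [], seen => rfl
  | a :: l, seen => by rw [List.foldl_cons, dedupStep_apply, foldl_dedupStep w l]; rfl

/-- **Value of `dedupFn` on a coded list.** [folklore] -/
theorem dedupFn_encList (x : List Bool) (l : List (List Bool)) : dedupFn (boolPair x (encList l)) = encList (dedupModel l []) := by
  rw [dedupFn, foldFn_boolPair, decNil_encList]
  exact foldl_dedupStep _ l []

/-- Step of the lookup fold on `⟨⟨q, T⟩, ⟨item, acc⟩⟩`: the second field of `item` if its first
field has the value `⟦q⟧`, else `acc`. [folklore] -/
def lkStep : List Bool → List Bool := iteFn (itemTest headEqFn) (sndF ∘ nthF 1) (sndPow 1)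

/-- `lkStep ∈ FP`. [folklore] -/
theorem lkStep_mem_FP : lkStep ∈ FP :=
  iteFn_mem_FP (itemTest_mem_FP headEqFn_mem_FP) (comp_mem_FP sndF_mem_FP (nthF_mem_FP 1)) (sndPow_mem_FP 1)

/-- `lkStep` on every input. [folklore] -/
theorem lkStep_eq (v : List Bool) :
    lkStep v = if itemTest headEqFn v = [true] then sndF (nthF 1 v) else sndPow 1 v := by
  have h1 : OneBit (itemTest headEqFn) := oneBit_headEqFn.comp (fanoutFn (fstF ∘ nthF 0) (nthF 1))
  rw [lkStep, iteFn_of_oneBit h1]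
  rfl

/-- Growth of the lookup step: `FoldGrowth 0`. [folklore] -/
theorem foldGrowth_lkStep : FoldGrowth 0 lkStep := fun v => by
  have h3 : sndPow 1 v = sndF (sndF v) := rfl
  have h4 : nthF 1 v = fstF (sndF v) := rfl
  have h5 := length_fstF_sndF_le (fstF (sndF v))
  rw [lkStep_eq]
  split_ifs
  · rw [h4]; omega
  · rw [h3]; omega

/-- `lkStep` on a step record. [folklore] -/
theorem lkStep_apply (q T item acc : List Bool) :
    lkStep (boolPair (boolPair q T) (boolPair item acc)) =
      if bitsToNat q = bitsToNat (fstF item) then sndF item else acc := by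
  rw [lkStep_eq, itemTest_apply, fstF_boolPair, headEqFn_boolPair]
  by_cases h : bitsToNat q = bitsToNat (fstF item)
  · rw [if_pos (by simp [h]), if_pos h]; simp [nthF]
  · rw [if_neg (by simp [h]), if_neg h]; simp [sndPow]

/-- **The table lookup** `lookupFn ⟨q, T⟩`: the second field of the LAST item of the coded list `T`
whose first field has the value `⟦q⟧`; `q` itself if there is none. [cite: AroraBarak2009, §1.3 (bounded loops)] -/
def lookupFn : List Bool → List Bool := foldFn lkStep fstF

/-- `lookupFn ∈ FP`. [cite: AroraBarak2009, §1.3] -/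
theorem lookupFn_mem_FP : lookupFn ∈ FP := foldFn_mem_FP lkStep_mem_FP fstF_mem_FP foldGrowth_lkStep

/-- The list-level model of the lookup: the value bound to `a` by the last binding of `tbl`,
default `a`. [folklore] -/
def posOf (tbl : List (ℕ × ℕ)) (a : ℕ) : ℕ := tbl.foldl (fun acc p => if p.1 = a then p.2 else acc) a

/-- The code of a binding. [folklore] -/
def bindCode (p : ℕ × ℕ) : List Bool := boolPair (encodeNat p.1) (encodeNat p.2)

/-- The code of a table of bindings. [folklore] -/
def tblCode (tbl : List (ℕ × ℕ)) : List Bool := encList (tbl.map bindCode)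

/-- The lookup fold over coded bindings. [folklore] -/
theorem foldl_lkStep (a : ℕ) (T : List Bool) : ∀ (tbl : List (ℕ × ℕ)) (acc : ℕ),
    (tbl.map bindCode).foldl (fun acc item => lkStep (boolPair (boolPair (encodeNat a) T) (boolPair item acc))) (encodeNat acc) =
      encodeNat (tbl.foldl (fun acc p => if p.1 = a then p.2 else acc) acc)
  | [], acc => rfl
  | p :: tbl, acc => by
    rw [List.map_cons, List.foldl_cons, List.foldl_cons, lkStep_apply]
    have h : (bitsToNat (encodeNat a) = bitsToNat (fstF (bindCode p))) ↔ p.1 = a := by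
      rw [bindCode, fstF_boolPair, bitsToNat_encodeNat, bitsToNat_encodeNat]; exact eq_comm
    by_cases hp : p.1 = a
    · rw [if_pos (h.2 hp), if_pos hp, bindCode, sndF_boolPair]
      exact foldl_lkStep a T tbl p.2
    · rw [if_neg (fun h' => hp (h.1 h')), if_neg hp]
      exact foldl_lkStep a T tbl acc

/-- **Value of `lookupFn` on a numeral and a coded table.** [folklore] -/
theorem lookupFn_tblCode (a : ℕ) (tbl : List (ℕ × ℕ)) :
    lookupFn (boolPair (encodeNat a) (tblCode tbl)) = encodeNat (posOf tbl a) := by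
  rw [lookupFn, foldFn_boolPair, fstF_boolPair, tblCode, decNil_encList]
  exact foldl_lkStep a _ tbl a

/-- `posOf` after one more binding. [folklore] -/
theorem posOf_append_singleton (tbl : List (ℕ × ℕ)) (k v a : ℕ) :
    posOf (tbl ++ [(k, v)]) a = if k = a then v else posOf tbl a := by
  simp [posOf, List.foldl_append]

/-- `encList` is a monoid morphism (twin of `UniversalStepBounds.encList_append`, not imported here). [folklore] -/
theorem encList_append' (l l' : List (List Bool)) : encList (l ++ l') = encList l ++ encList l' := by
  induction l with
  | nil => rfl
  | cons a l ih => rw [List.cons_append, encList_cons, encList_cons, ih]; simp [boolPair, List.append_assoc]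

/-- `tblCode` after one more binding. [folklore] -/
theorem tblCode_append_singleton (tbl : List (ℕ × ℕ)) (p : ℕ × ℕ) :
    tblCode (tbl ++ [p]) = tblCode tbl ++ boolPair (bindCode p) [] := by
  rw [tblCode, tblCode, List.map_append, encList_append', List.map_singleton, encList_cons, encList_nil]


/-! ### The touched wires: de-duplication, cardinality and ranks -/

/-- The rank of a touched wire is the number of smaller touched wires. [folklore] -/
theorem rankIn_val (T : Finset (Fin n)) (i : Fin n) (hi : i ∈ T) :
    ((rankIn T i hi : Fin T.card) : ℕ) = (T.filter (· < i)).card := by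
  set k := rankIn T i hi with hk
  have hfk : T.orderEmbOfFin rfl k = i := orderEmbOfFin_rankIn T i hi
  have h : T.filter (· < i) = (Finset.Iio k).map (T.orderEmbOfFin rfl).toEmbedding := by
    ext x
    simp only [Finset.mem_filter, Finset.mem_map, Finset.mem_Iio, RelEmbedding.coe_toEmbedding]
    constructor
    · rintro ⟨hx, hxi⟩
      have hx' : x ∈ Set.range (T.orderEmbOfFin rfl) := by rw [Finset.range_orderEmbOfFin]; exact hx
      obtain ⟨j, rfl⟩ := hx'
      refine ⟨j, ?_, rfl⟩
      rw [← hfk] at hxi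
      exact (T.orderEmbOfFin rfl).lt_iff_lt.1 hxi
    · rintro ⟨j, hj, rfl⟩
      refine ⟨Finset.orderEmbOfFin_mem T rfl j, ?_⟩
      rw [← hfk]
      exact (T.orderEmbOfFin rfl).lt_iff_lt.2 hj
  rw [h, Finset.card_map, Fin.card_Iio]

/-- Wire indices are below the number of wires. [folklore] -/
theorem lt_of_mem_allWireVals {G : QGateSet} {gs : List (QGate G n)} {v : ℕ} (hv : v ∈ allWireVals gs) : v < n := by
  simp only [allWireVals, List.mem_flatMap] at hv
  obtain ⟨g, -, hg⟩ := hv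
  rcases g with ⟨op, e⟩ | ⟨k, e⟩ <;>
  · simp only [wireVals, List.mem_ofFn] at hg
    obtain ⟨i, rfl⟩ := hg
    exact Fin.is_lt _

/-- **The distinct wire indices**: the de-duplicated list of all wire indices (a list without
repetition with the same members). [folklore] -/
def distinctWires {G : QGateSet} (gs : List (QGate G n)) : List ℕ := dedupModel (allWireVals gs) []

/-- `distinctWires` has no duplicates. [folklore] -/
theorem nodup_distinctWires {G : QGateSet} (gs : List (QGate G n)) : (distinctWires gs).Nodup :=
  nodup_dedupModel _ _ List.nodup_nil

/-- `distinctWires` has the members of `allWireVals`. [folklore] -/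
theorem mem_distinctWires_iff {G : QGateSet} (gs : List (QGate G n)) (v : ℕ) : v ∈ distinctWires gs ↔ v ∈ allWireVals gs := by
  rw [distinctWires, mem_dedupModel_iff]; simp

/-- The touched wires, as naturals, are the distinct wire indices. [folklore] -/
theorem map_val_touchedWires {G : QGateSet} (gs : List (QGate G n)) :
    (touchedWires gs).map Fin.valEmbedding = (distinctWires gs).toFinset := by
  ext x
  simp only [Finset.mem_map, Fin.valEmbedding_apply, List.mem_toFinset, mem_distinctWires_iff]
  constructor
  · rintro ⟨w, hw, rfl⟩
    exact (mem_touchedWires_iff gs w).1 hw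
  · intro hx
    exact ⟨⟨x, lt_of_mem_allWireVals hx⟩, (mem_touchedWires_iff gs _).2 hx, rfl⟩

/-- **The number of touched wires is the number of distinct wire indices.** [folklore] -/
theorem card_touchedWires_eq {G : QGateSet} (gs : List (QGate G n)) : (touchedWires gs).card = (distinctWires gs).length := by
  rw [← Finset.card_map Fin.valEmbedding, map_val_touchedWires, List.toFinset_card_of_nodup (nodup_distinctWires gs)]

/-- **The rank of a touched wire is `ψ` over the distinct wire indices**: the number of distinct
smaller wire indices. [folklore] -/
theorem rankIn_val_eq_psi {G : QGateSet} (gs : List (QGate G n)) (i : Fin n) (hi : i ∈ touchedWires gs) :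
    ((rankIn (touchedWires gs) i hi : Fin (touchedWires gs).card) : ℕ) = psi (distinctWires gs) i := by
  rw [rankIn_val, psi, List.countP_eq_length_filter,
    ← List.toFinset_card_of_nodup ((nodup_distinctWires gs).filter _), ← Finset.card_map Fin.valEmbedding]
  congr 1
  ext x
  simp only [Finset.mem_map, Finset.mem_filter, Fin.valEmbedding_apply, List.mem_toFinset, List.mem_filter,
    mem_distinctWires_iff, decide_eq_true_eq]
  constructor
  · rintro ⟨w, ⟨hw, hlt⟩, rfl⟩
    exact ⟨(mem_touchedWires_iff gs w).1 hw, hlt⟩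
  · rintro ⟨hx, hlt⟩
    exact ⟨⟨x, lt_of_mem_allWireVals hx⟩, ⟨(mem_touchedWires_iff gs _).2 hx, hlt⟩, rfl⟩

/-! ### The codes of the compressed, lifted gates -/

/-- The code of the compressed (and lifted) gate of an oracle-free gate: the same symbol and
arity, every wire replaced by its rank. [cite: AaronsonAmbainis2018, §6 (proof of Thm. 25)] -/
def cmpCode (D : List ℕ) : QGate hCCSign n → List Bool
  | .gate HCCSignOp.H e => false :: boolPair [] (listNatCode [psi D (hPlacement e 0)])
  | .gate HCCSignOp.CCSIGN e =>
      false :: boolPair [true] (listNatCode [psi D (ccsignPlacement e 0), psi D (ccsignPlacement e 1), psi D (ccsignPlacement e 2)])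
  | .oracle _ _ => []

/-- One idle wire does not change the code of a gate. [folklore] -/
theorem encode_liftGateSucc {G : QGateSet} [Encodable G.Op] (g : QGate G n) : (liftGateSucc g).encode = g.encode := by
  rcases g with ⟨op, e⟩ | ⟨k, e⟩ <;> rfl

/-- Idle wires do not change the code of a gate. [folklore] -/
theorem encode_liftGateBy {G : QGateSet} [Encodable G.Op] : ∀ (t : ℕ) (g : QGate G n), (Thm25Asm.liftGateBy t g).encode = g.encode
  | 0, _ => rfl
  | t + 1, g => by rw [Thm25Asm.liftGateBy, encode_liftGateSucc, encode_liftGateBy t g]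

/-- **The code of a compressed, lifted gate.** [folklore] -/
theorem encode_compressGate (gs : List (QGate hCCSign n)) (t : ℕ) (g : QGate hCCSign n) (hg : g.IsOracleFree)
    (h : g.wires ⊆ touchedWires gs) :
    (Thm25Asm.liftGateBy t (compressGate (touchedWires gs) g h)).encode = cmpCode (distinctWires gs) g := by
  rw [encode_liftGateBy]
  rcases g with ⟨op, e⟩ | ⟨k, e⟩
  · rcases op with _ | _
    · have hw : ∀ i : Fin 1, ((compressEmb (touchedWires gs) e fun j => h (apply_mem_wires_gate (G := hCCSign) HCCSignOp.H e j)) i : ℕ) =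
          psi (distinctWires gs) (e i) := fun i => rankIn_val_eq_psi gs (e i) _
      change (QGate.gate (G := hCCSign) HCCSignOp.H (compressEmb (touchedWires gs) e fun j => h (apply_mem_wires_gate (G := hCCSign) HCCSignOp.H e j))).encode = _
      rw [encode_gate_eq]
      exact congrArg (fun l => false :: boolPair [] (listNatCode l)) (List.ofFn_inj.2 (funext hw))
    · have hw : ∀ i : Fin 3, ((compressEmb (touchedWires gs) e fun j => h (apply_mem_wires_gate (G := hCCSign) HCCSignOp.CCSIGN e j)) i : ℕ) =
          psi (distinctWires gs) (e i) := fun i => rankIn_val_eq_psi gs (e i) _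
      change (QGate.gate (G := hCCSign) HCCSignOp.CCSIGN (compressEmb (touchedWires gs) e fun j => h (apply_mem_wires_gate (G := hCCSign) HCCSignOp.CCSIGN e j))).encode = _
      rw [encode_gate_eq]
      exact congrArg (fun l => false :: boolPair [true] (listNatCode l)) (List.ofFn_inj.2 (funext hw))
  · exact absurd hg id

/-- **The gate codes of the compressed, lifted circuit.** [folklore] -/
theorem map_encode_lift_compress (t : ℕ) (Q : QCircuit hCCSign n) (hQ : Q.IsOracleFree) :
    (liftCircuitBy t (compress Q)).gates.map QGate.encode = Q.gates.map (cmpCode (distinctWires Q.gates)) := by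
  rw [Thm25Asm.gates_liftCircuitBy]
  change ((Q.gates.pmap (compressGate (touchedWires Q.gates)) fun _ hg => wires_subset_touchedWires hg).map
    (Thm25Asm.liftGateBy t)).map QGate.encode = _
  rw [List.map_map, List.map_pmap]
  exact (List.pmap_congr_left Q.gates fun g hg h₁ _ => encode_compressGate Q.gates t g (hQ g hg) h₁).trans
    (List.pmap_eq_map fun _ hg => wires_subset_touchedWires hg)

/-- The new gate code on `⟨D, c⟩`: `0 :: ⟨sym c, ⟨arity c, ψ_D (wires c)⟩⟩` (the symbol and the
arity copied, the wires ranked). [cite: AaronsonAmbainis2018, §6 Thm. 25] -/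
def cmpGateFn : List Bool → List Bool := List.cons false ∘ fanoutFn symOf (fanoutFn arityOf newWires)

/-- `cmpGateFn ∈ FP`. [cite: AroraBarak2009, §1.3] -/
theorem cmpGateFn_mem_FP : cmpGateFn ∈ FP :=
  comp_mem_FP (cons_mem_FP false) (fanoutFn_mem_FP (comp_mem_FP fstF_mem_FP tailCode_mem_FP)
    (fanoutFn_mem_FP (comp_mem_FP (nthF_mem_FP 1) tailCode_mem_FP) newWires_mem_FP))

/-- **Size of the new gate code**: `|cmpGateFn ⟨D, c⟩| ≤ |c| + 6|D| + 11`. [folklore] -/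
theorem length_cmpGateFn_le (D c : List Bool) : (cmpGateFn (boolPair D c)).length ≤ c.length + 6 * D.length + 11 := by
  have h1 := length_fstF_sndF_le c.tail
  have h2 := length_fstF_sndF_le (sndF c.tail)
  have h3 := length_newWires_le D c
  have h4 : c.tail.length ≤ c.length := by simp
  have e1 : symOf (boolPair D c) = fstF c.tail := by simp [symOf, tailCode]
  have e2 : arityOf (boolPair D c) = fstF (sndF c.tail) := by simp [arityOf, tailCode, nthF]
  simp only [cmpGateFn, Function.comp_apply, fanoutFn_apply, List.length_cons, length_boolPair, e1, e2]
  omega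

/-- **`cmpGateFn` on the code of an oracle-free gate is the code of the compressed gate.**
[cite: AaronsonAmbainis2018, §6 Thm. 25] -/
theorem cmpGateFn_encode (D : List ℕ) (g : QGate hCCSign n) (hg : g.IsOracleFree) :
    cmpGateFn (boolPair (encList (D.map encodeNat)) g.encode) = cmpCode D g := by
  rcases g with ⟨_ | _, e⟩ | ⟨k, e⟩
  · have hc : QGate.encode (QGate.gate (G := hCCSign) (n := n) HCCSignOp.H e) =
        false :: boolPair [] (listNatCode [(hPlacement e 0 : ℕ)]) := by
      rw [QGate.encode, encodingListNatBool_encode]; rfl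
    have hs : symOf (boolPair (encList (D.map encodeNat)) (false :: boolPair [] (listNatCode [(hPlacement e 0 : ℕ)]))) = [] := by
      simp [symOf, tailCode]
    rw [hc, cmpGateFn, Function.comp_apply, fanoutFn_apply, fanoutFn_apply, newWires_apply, if_pos hs, hs]
    simp only [oneWire, psiAt, arityOf, wiresOf, tailCode, fanoutFn_apply, Function.comp_apply, sndF_boolPair,
      List.tail_cons, nthF_succ_boolPair, nthF_zero_boolPair, fstF_boolPair, sndPow_succ_boolPair, sndPow_zero,
      listNatCode, List.map_cons, List.map_nil, encList_cons, encList_nil, List.length_singleton, psiFn_encodeNat]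
    rfl
  · have hc : QGate.encode (QGate.gate (G := hCCSign) (n := n) HCCSignOp.CCSIGN e) =
        false :: boolPair [true] (listNatCode [(ccsignPlacement e 0 : ℕ), (ccsignPlacement e 1 : ℕ), (ccsignPlacement e 2 : ℕ)]) := by
      rw [QGate.encode, encodingListNatBool_encode]; rfl
    have hs : symOf (boolPair (encList (D.map encodeNat))
        (false :: boolPair [true] (listNatCode [(ccsignPlacement e 0 : ℕ), (ccsignPlacement e 1 : ℕ), (ccsignPlacement e 2 : ℕ)]))) = [true] := by
      simp [symOf, tailCode]
    rw [hc, cmpGateFn, Function.comp_apply, fanoutFn_apply, fanoutFn_apply, newWires_apply, if_neg (by rw [hs]; simp), hs]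
    simp only [threeWires, psiAt, arityOf, wiresOf, tailCode, fanoutFn_apply, Function.comp_apply, sndF_boolPair,
      List.tail_cons, nthF_succ_boolPair, nthF_zero_boolPair, fstF_boolPair, sndPow_succ_boolPair, sndPow_zero,
      listNatCode, List.map_cons, List.map_nil, encList_cons, encList_nil, psiFn_encodeNat]
    rfl
  · exact absurd hg id

/-- Step of the body fold: append the coded new gate code of the item. [folklore] -/
def cmpStep : List Bool → List Bool :=
  fun z => sndPow 1 z ++ fanoutFn (cmpGateFn ∘ fanoutFn (fstF ∘ nthF 0) (nthF 1)) (fun _ => []) z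

/-- `cmpStep ∈ FP`. [folklore] -/
theorem cmpStep_mem_FP : cmpStep ∈ FP :=
  append_mem_FP (sndPow_mem_FP 1) (fanoutFn_mem_FP (comp_mem_FP cmpGateFn_mem_FP
    (fanoutFn_mem_FP (comp_mem_FP fstF_mem_FP (nthF_mem_FP 0)) (nthF_mem_FP 1))) (const_mem_FP _))

/-- `cmpStep` on a step record. [folklore] -/
@[simp] theorem cmpStep_apply (u c acc : List Bool) :
    cmpStep (boolPair u (boolPair c acc)) = acc ++ boolPair (cmpGateFn (boolPair (fstF u) c)) [] := by
  simp [cmpStep]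

/-- **Growth of the body fold** (`FoldGrowth 30`). [folklore] -/
theorem foldGrowth_cmpStep : FoldGrowth 30 cmpStep := fun v => by
  have h3 : sndPow 1 v = sndF (sndF v) := rfl
  have h4 : nthF 1 v = fstF (sndF v) := rfl
  have hW := length_fstF_sndF_le (fstF v)
  have hg := length_cmpGateFn_le (fstF (fstF v)) (fstF (sndF v))
  simp only [cmpStep, fanoutFn_apply, Function.comp_apply, nthF_zero, List.length_append, length_boolPair,
    List.length_nil, h3, h4]
  nlinarith

/-- **The new body**: `⟨D, encList [c₁, …, c_m]⟩ ↦ encList [cmpGate ⟨D, c₁⟩, …, cmpGate ⟨D, c_m⟩]`. [folklore] -/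
def cmpBodyFn : List Bool → List Bool := foldFn cmpStep (fun _ => [])

/-- `cmpBodyFn ∈ FP`. [cite: AroraBarak2009, §1.3] -/
theorem cmpBodyFn_mem_FP : cmpBodyFn ∈ FP := foldFn_mem_FP cmpStep_mem_FP (const_mem_FP _) foldGrowth_cmpStep

/-- Value of `cmpBodyFn` on a pair. [folklore] -/
theorem cmpBodyFn_boolPair (D L : List Bool) :
    cmpBodyFn (boolPair D L) = encList ((decNil L).map fun c => cmpGateFn (boolPair D c)) := by
  rw [cmpBodyFn, foldFn_boolPair]
  simp only [cmpStep_apply, fstF_boolPair]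
  rw [foldl_append_boolPair_eq, List.nil_append]

/-- **`cmpBodyFn` computes the gate codes of the compressed, lifted circuit.** [cite: AaronsonAmbainis2018, §6 Thm. 25] -/
theorem cmpBodyFn_encode (t : ℕ) (Q : QCircuit hCCSign n) (hQ : Q.IsOracleFree) :
    cmpBodyFn (boolPair (encList ((distinctWires Q.gates).map encodeNat)) (encList (Q.gates.map QGate.encode))) =
      encList ((liftCircuitBy t (compress Q)).gates.map QGate.encode) := by
  rw [cmpBodyFn_boolPair, decNil_encList, map_encode_lift_compress t Q hQ, List.map_map]
  congr 1
  refine List.map_congr_left fun g hg => ?_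
  simp only [Function.comp_apply]
  exact cmpGateFn_encode _ g (hQ g hg)

/-! ### The number of Hadamard gates -/

/-- The Hadamard mark of a gate code: `1` if the symbol field of the (untagged) code is empty
(`H` has symbol code `0 = ε`), else `ε`. [folklore] -/
def hMark : List Bool → List Bool := iteFn (isNilFn ∘ fstF ∘ List.tail) (fun _ => [true]) (fun _ => [])

/-- `hMark ∈ FP`. [folklore] -/
theorem hMark_mem_FP : hMark ∈ FP :=
  iteFn_mem_FP (comp_mem_FP isNilFn_mem_FP (comp_mem_FP fstF_mem_FP PRelSigma.tail_mem_FP)) (const_mem_FP _) (const_mem_FP _)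

/-- Value of `hMark`. [folklore] -/
theorem hMark_apply (c : List Bool) : hMark c = if fstF c.tail = [] then [true] else [] := by
  rw [hMark, iteFn_of_oneBit (oneBit_isNilFn.comp _)]
  by_cases h : fstF c.tail = [] <;> simp [isNilFn, h]

/-- `|hMark c| ≤ 1`. [folklore] -/
theorem length_hMark_le (c : List Bool) : (hMark c).length ≤ 1 := by
  rw [hMark_apply]; split_ifs <;> simp

/-- The Hadamard indicator of a gate. [folklore] -/
def isHGate : QGate hCCSign n → Bool
  | .gate HCCSignOp.H _ => true
  | _ => false

/-- `hMark` on the code of an oracle-free gate. [folklore] -/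
theorem hMark_encode (g : QGate hCCSign n) (hg : g.IsOracleFree) : hMark g.encode = if isHGate g then [true] else [] := by
  rcases g with ⟨_ | _, e⟩ | ⟨k, e⟩
  · rw [hMark_apply, QGate.encode]; rfl
  · rw [hMark_apply, QGate.encode]; rfl
  · exact absurd hg id

/-- `hadamardCount` counts the Hadamard gates. [folklore] -/
theorem hadamardCount_eq_countP : ∀ gs : List (QGate hCCSign n), hadamardCount gs = gs.countP isHGate
  | [] => rfl
  | .gate HCCSignOp.H _ :: gs => by rw [hadamardCount, List.countP_cons_of_pos (by rfl), hadamardCount_eq_countP gs]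
  | .gate HCCSignOp.CCSIGN _ :: gs => by rw [hadamardCount, List.countP_cons_of_neg (by simp [isHGate]), hadamardCount_eq_countP gs]
  | .oracle _ _ :: gs => by rw [hadamardCount, List.countP_cons_of_neg (by simp [isHGate]), hadamardCount_eq_countP gs]

/-- Compression does not change the number of Hadamard gates. [folklore] -/
theorem hadamardCount_compress (Q : QCircuit hCCSign n) : hadamardCount (compress Q).gates = hadamardCount Q.gates := by
  change hadamardCount (Q.gates.pmap (compressGate (touchedWires Q.gates)) fun _ hg => wires_subset_touchedWires hg) = _
  suffices h : ∀ (gs : List (QGate hCCSign n)) (H : ∀ g ∈ gs, g.wires ⊆ touchedWires Q.gates),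
      hadamardCount (gs.pmap (compressGate (touchedWires Q.gates)) H) = hadamardCount gs from h _ _
  intro gs
  induction gs with
  | nil => intro H; rfl
  | cons g gs ih =>
    intro H
    rw [List.pmap]
    rcases g with ⟨_ | _, e⟩ | ⟨k, e⟩
    · exact congrArg (· + 1) (ih _)
    · exact ih _
    · exact ih _

/-- Step of the Hadamard tally: append the mark of the item. [folklore] -/
def hcStep : List Bool → List Bool := fun z => sndPow 1 z ++ hMark (nthF 1 z)

/-- `hcStep ∈ FP`. [folklore] -/
theorem hcStep_mem_FP : hcStep ∈ FP := by
  show (fun z => sndPow 1 z ++ (hMark ∘ nthF 1) z) ∈ FP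
  exact append_mem_FP (sndPow_mem_FP 1) (comp_mem_FP hMark_mem_FP (nthF_mem_FP 1))

/-- **The unary tally of the Hadamard gates**: `⟨x, encList codes⟩ ↦ 1^{#H}`. [cite: AaronsonAmbainis2018, §6 (proof of Thm. 25: the parity of the number of Hadamard gates)] -/
def hCountFn : List Bool → List Bool := foldFn hcStep (fun _ => [])

/-- `hCountFn ∈ FP`. [cite: AroraBarak2009, §1.3] -/
theorem hCountFn_mem_FP : hCountFn ∈ FP :=
  foldFn_mem_FP hcStep_mem_FP (const_mem_FP _) (c := 1) fun v => by
    have h1 := length_hMark_le (nthF 1 v)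
    have h3 : (sndPow 1 v).length = (sndF (sndF v)).length := rfl
    simp only [hcStep, List.length_append]
    omega

/-- Value of `hCountFn` on a pair. [folklore] -/
theorem hCountFn_boolPair (x L : List Bool) : hCountFn (boolPair x L) = ((decNil L).map hMark).flatten := by
  rw [hCountFn, foldFn_boolPair]
  have h : ∀ acc a : List Bool, hcStep (boolPair (boolPair x L) (boolPair a acc)) = acc ++ hMark a := fun acc a => by
    simp [hcStep]
  simp only [h]
  rw [foldl_append_eq, List.nil_append]

/-- The marks of the codes of an oracle-free gate list tally its Hadamard gates. [folklore] -/
theorem flatten_map_hMark_encode : ∀ (gs : List (QGate hCCSign n)), (∀ g ∈ gs, g.IsOracleFree) →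
    ((gs.map QGate.encode).map hMark).flatten = ones (hadamardCount gs)
  | [], _ => rfl
  | g :: gs, h => by
    rw [List.map_cons, List.map_cons, List.flatten_cons, hMark_encode g (h g List.mem_cons_self),
      flatten_map_hMark_encode gs fun g' hg' => h g' (List.mem_cons_of_mem _ hg'), hadamardCount_eq_countP,
      hadamardCount_eq_countP, List.countP_cons]
    by_cases hg : isHGate g = true
    · rw [if_pos hg, if_pos hg]; rfl
    · rw [if_neg hg, if_neg hg]; rfl

/-- **`hCountFn` on the code of an oracle-free instance.** [folklore] -/
theorem hCountFn_encode (I : QSimInstance) (hI : I.circuit.IsOracleFree) :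
    hCountFn I.encode = ones (hadamardCount I.circuit.gates) := by
  rw [QSimInstance.encode, encode_eq_encList, hCountFn_boolPair, decNil_encList]
  exact flatten_map_hMark_encode _ hI


/-! ### The numerals `n_c`, `n' = n_c + (n_c mod 2)` and `N = n' + 1` -/

/-- On the code of an instance: the coded list `D` of the distinct wire numerals. [folklore] -/
def dFn : List Bool → List Bool := dedupFn ∘ fanoutFn (fun _ => []) allWiresFn

/-- `dFn ∈ FP`. [folklore] -/
theorem dFn_mem_FP : dFn ∈ FP := comp_mem_FP dedupFn_mem_FP (fanoutFn_mem_FP (const_mem_FP _) allWiresFn_mem_FP)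

/-- **`dFn` on the code of an instance**: the coded list of the distinct wire numerals. [folklore] -/
theorem dFn_encode (I : QSimInstance) : dFn I.encode = encList ((distinctWires I.circuit.gates).map encodeNat) := by
  rw [dFn, Function.comp_apply, fanoutFn_apply, allWiresFn_encode, dedupFn_encList, distinctWires,
    ← dedupModel_map encodeNat_injective _ [], List.map_nil]

/-- On the code of an instance: the unary numeral `1^{n_c}` of the number of touched wires. [folklore] -/
def ncUFn : List Bool → List Bool := countFn ∘ fanoutFn (fun _ => []) dFn

/-- `ncUFn ∈ FP`. [folklore] -/
theorem ncUFn_mem_FP : ncUFn ∈ FP := comp_mem_FP countFn_mem_FP (fanoutFn_mem_FP (const_mem_FP _) dFn_mem_FP)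

/-- `ncUFn` on the code of an instance. [folklore] -/
theorem ncUFn_encode (I : QSimInstance) : ncUFn I.encode = ones I.wireCount := by
  rw [show I.wireCount = (distinctWires I.circuit.gates).length from card_touchedWires_eq _, ncUFn, Function.comp_apply,
    fanoutFn_apply, dFn_encode, countFn_boolPair, decNil_encList, List.length_map]

/-- On the code of an instance: the binary numeral of `n_c`. [folklore] -/
def ncBFn : List Bool → List Bool := lenBinF ∘ ncUFn

/-- `ncBFn ∈ FP`. [folklore] -/
theorem ncBFn_mem_FP : ncBFn ∈ FP := comp_mem_FP lenBinF_mem_FP ncUFn_mem_FP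

/-- `ncBFn` on the code of an instance. [folklore] -/
theorem ncBFn_encode (I : QSimInstance) : ncBFn I.encode = encodeNat I.wireCount := by
  rw [ncBFn, Function.comp_apply, ncUFn_encode, lenBinF_apply, List.length_replicate]

/-- The parity bit as a number: `[¬ Even m]` has the value `m mod 2`. [folklore] -/
theorem toNat_not_even (m : ℕ) : (!decide (Even m)).toNat = m % 2 := by
  rcases Nat.even_or_odd m with h | h
  · rw [Nat.even_iff.1 h]; simp [h]
  · rw [Nat.odd_iff.1 h]; simp [Nat.not_even_iff_odd.2 h]

/-- On the code of an instance: the binary numeral of `n' = n_c + (n_c mod 2)` (the number of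
logical wires after the idle wire making it even). [cite: AaronsonAmbainis2018, §6 (proof of Thm. 25)] -/
def npFn : List Bool → List Bool := addFn ∘ fanoutFn ncBFn (notFn parityFn ∘ ncBFn)

/-- `npFn ∈ FP`. [folklore] -/
theorem npFn_mem_FP : npFn ∈ FP :=
  comp_mem_FP addFn_mem_FP (fanoutFn_mem_FP ncBFn_mem_FP (comp_mem_FP (notFn_mem_FP parityFn_mem_FP) ncBFn_mem_FP))

/-- The even number of logical wires of an instance: `n' = n_c + (n_c mod 2)`. [cite: AaronsonAmbainis2018, §6 (proof of Thm. 25)] -/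
abbrev nLog (I : QSimInstance) : ℕ := I.wireCount + I.wireCount % 2

/-- `npFn` on the code of an instance. [folklore] -/
theorem npFn_encode (I : QSimInstance) : npFn I.encode = encodeNat (nLog I) := by
  have hp : notFn parityFn (encodeNat I.wireCount) = [!decide (Even I.wireCount)] := by
    rw [notFn_apply (c := parityFn) (b := decide (Even I.wireCount))]
    rw [parityFn, bitsToNat_encodeNat]
  rw [npFn, Function.comp_apply, fanoutFn_apply, Function.comp_apply, ncBFn_encode, addFn_boolPair, bitsToNat_encodeNat, hp, nLog,
    bitsToNat_cons, bitsToNat_nil, toNat_not_even, Nat.mul_zero, Nat.add_zero]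

/-- On the code of an instance: the binary numeral of `N = n' + 1`. [folklore] -/
def nFn : List Bool → List Bool := addFn ∘ fanoutFn npFn (fun _ => [true])

/-- `nFn ∈ FP`. [folklore] -/
theorem nFn_mem_FP : nFn ∈ FP := comp_mem_FP addFn_mem_FP (fanoutFn_mem_FP npFn_mem_FP (const_mem_FP _))

/-- `nFn` on the code of an instance. [folklore] -/
theorem nFn_encode (I : QSimInstance) : nFn I.encode = encodeNat (nLog I + 1) := by
  rw [nFn, Function.comp_apply, fanoutFn_apply, npFn_encode, addFn_boolPair, bitsToNat_encodeNat]
  rfl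

/-! ### Size estimates on codes -/

/-- A gate has at most as many wires as its code has symbols. [folklore] -/
theorem length_wireVals_le {G : QGateSet} [Encodable G.Op] (g : QGate G n) : (wireVals g).length ≤ g.encode.length := by
  rcases g with ⟨op, e⟩ | ⟨k, e⟩ <;>
  · rw [QGate.encode, encodingListNatBool_encode, listNatCode, List.length_cons, length_boolPair, length_boolPair,
      Thm25Lex.unaryEncodeNat_eq_replicate, List.length_replicate, List.length_ofFn]
    simp [wireVals]
    omega

/-- The wire indices of a gate list are fewer than the symbols of its code. [folklore] -/
theorem length_allWireVals_le {G : QGateSet} [Encodable G.Op] : ∀ gs : List (QGate G n),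
    (allWireVals gs).length ≤ (encList (gs.map QGate.encode)).length
  | [] => le_rfl
  | g :: gs => by
    rw [allWireVals, List.flatMap_cons, List.length_append, List.map_cons, encList_cons, length_boolPair]
    have h1 := length_wireVals_le g
    have h2 := length_allWireVals_le gs
    rw [allWireVals] at h2
    omega

/-- The de-duplicated list is no longer than the input plus the seed. [folklore] -/
theorem length_dedupModel_le {α : Type*} [DecidableEq α] : ∀ (l seen : List α), (dedupModel l seen).length ≤ l.length + seen.length
  | [], seen => by simp [dedupModel]
  | a :: l, seen => by
    rw [dedupModel_cons]
    split_ifs with h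
    · have := length_dedupModel_le l seen
      simp only [List.length_cons]; omega
    · have := length_dedupModel_le l (a :: seen)
      simp only [List.length_cons] at this ⊢; omega

/-- **`n' ≤ |code| + 1`**: the number of logical wires is linear in the length of the code. [folklore] -/
theorem nLog_le (I : QSimInstance) : nLog I ≤ I.encode.length + 1 := by
  have h0 : I.wireCount = (distinctWires I.circuit.gates).length := card_touchedWires_eq _
  have h1 := length_dedupModel_le (allWireVals I.circuit.gates) []
  have h2 := length_allWireVals_le I.circuit.gates
  have h3 : (encList (I.circuit.gates.map QGate.encode)).length ≤ I.encode.length := by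
    rw [QSimInstance.encode, encode_eq_encList, length_boolPair]; omega
  have h4 := Nat.mod_lt I.wireCount two_pos
  rw [nLog]
  rw [distinctWires] at h0
  simp only [List.length_nil, add_zero] at h1
  omega

/-! ### The padding: the codes of one Hadamard gate per logical wire -/

/-- The code of the Hadamard gate on the wire with numeral `v`: `0 :: ⟨ε, ⟨1, ⟨v, ε⟩⟩⟩`. [folklore] -/
def hGateCode (v : List Bool) : List Bool := false :: boolPair [] (boolPair [true] (boolPair v []))

/-- The code of `hCCSignHOn a`. [folklore] -/
theorem encode_hCCSignHOn (a : Fin n) : (hCCSignHOn a).encode = hGateCode (encodeNat a) := by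
  rw [hCCSignHOn, encode_gate_eq]; rfl

/-- Length of `hGateCode`. [folklore] -/
theorem length_hGateCode (v : List Bool) : (hGateCode v).length = 2 * v.length + 9 := by
  simp only [hGateCode, List.length_cons, length_boolPair, List.length_nil]; omega

/-- The raw piece of the padding loop on `⟨x, 1ʲ⟩`: the list element of the code of `H` on wire
`j` (numeral `bin j = lenBinF 1ʲ`). [folklore] -/
def padPieceRaw : List Bool → List Bool :=
  fanoutFn (List.cons false ∘ fanoutFn (fun _ => []) (fanoutFn (fun _ => [true]) (fanoutFn (lenBinF ∘ sndF) (fun _ => []))))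
    (fun _ => [])

/-- `padPieceRaw ∈ FP`. [folklore] -/
theorem padPieceRaw_mem_FP : padPieceRaw ∈ FP :=
  fanoutFn_mem_FP (comp_mem_FP (cons_mem_FP false) (fanoutFn_mem_FP (const_mem_FP _) (fanoutFn_mem_FP (const_mem_FP _)
    (fanoutFn_mem_FP (comp_mem_FP lenBinF_mem_FP sndF_mem_FP) (const_mem_FP _))))) (const_mem_FP _)

/-- Value of `padPieceRaw` on `⟨x, 1ʲ⟩`. [folklore] -/
theorem padPieceRaw_apply (x : List Bool) (j : ℕ) : padPieceRaw (boolPair x (ones j)) = boolPair (hGateCode (encodeNat j)) [] := by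
  simp [padPieceRaw, hGateCode]

/-- The input record of the padding loop: `⟨z, ⟨bin n', ⟨1⁰, ε⟩⟩⟩`. [folklore] -/
def padIn : List Bool → List Bool := fanoutFn id (fanoutFn npFn (fun _ => boolPair [] []))

/-- `padIn ∈ FP`. [folklore] -/
theorem padIn_mem_FP : padIn ∈ FP := fanoutFn_mem_FP (PolyTimeComputable.id _) (fanoutFn_mem_FP npFn_mem_FP (const_mem_FP _))

/-- **The padding codes**: `z ↦ encList [code(H on 0), …, code(H on n' − 1)]` — the coded gate
list of `hOnAllWires n'`, by the counted fold `foldLoop appF` over `j < n'` (clipped pieces,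
`|z| + 1 ≥ n'` rounds). [cite: AaronsonAmbainis2018, §6 (proof of Thm. 25: the parity repair)] -/
def padFn : List Bool → List Bool := sndPow 2 ∘ foldLoop appF (clipF 24 padPieceRaw) (Polynomial.X + 1) ∘ padIn

/-- `padFn ∈ FP`. [cite: AroraBarak2009, §1.3 (bounded loops)] -/
theorem padFn_mem_FP : padFn ∈ FP :=
  comp_mem_FP (sndPow_mem_FP 2) (comp_mem_FP (foldLoop_clipF_mem_FP 24 appF_mem_FP length_appF_le padPieceRaw_mem_FP _) padIn_mem_FP)

/-- A `ccat` of list elements is a coded list. [folklore] -/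
theorem ccat_items (c : ℕ → List Bool) : ∀ k : ℕ, ccat (fun j => boolPair (c j) []) k = encList ((List.range k).map c)
  | 0 => rfl
  | k + 1 => by rw [ccat_succ, ccat_items c k, List.range_succ, List.map_append, encList_append', List.map_singleton]; rfl

/-- The coded gate list of the padding. [folklore] -/
theorem encList_hOnAllWires (m : ℕ) :
    encList ((hOnAllWires m).map QGate.encode) = encList ((List.range m).map fun j => hGateCode (encodeNat j)) := by
  rw [hOnAllWires, List.map_map, ← List.map_coe_finRange_eq_range (n := m), List.map_map]
  refine congrArg encList (List.map_congr_left fun a _ => ?_)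
  simp only [Function.comp_apply, encode_hCCSignHOn]

/-- **`padFn` on the code of an instance**: the coded gate list of `hOnAllWires n'`. [cite: AaronsonAmbainis2018, §6 (proof of Thm. 25)] -/
theorem padFn_encode (I : QSimInstance) : padFn I.encode = encList ((hOnAllWires (nLog I)).map QGate.encode) := by
  have hk : nLog I ≤ (Polynomial.X + 1 : Polynomial ℕ).eval I.encode.length := by simpa using nLog_le I
  rw [padFn, Function.comp_apply, Function.comp_apply, padIn, fanoutFn_apply, fanoutFn_apply, npFn_encode, id,
    show boolPair ([] : List Bool) [] = boolPair (ones 0) [] from rfl, foldLoop_apply _ _ hk 0 []]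
  simp only [sndPow, Function.comp_apply, sndF_boolPair]
  rw [foldAcc_clipF, foldAcc_appF, List.nil_append, encList_hOnAllWires]
  · simp only [Nat.zero_add, padPieceRaw_apply]
    exact ccat_items _ _
  · intro j _ hj
    rw [padPieceRaw_apply, length_boolPair, length_hGateCode, List.length_nil]
    have h1 := TokConv.length_encodeNat_le j
    have h2 := nLog_le I
    omega

/-! ### The codes of the shapes -/

/-- The code of the constant shape `1`: the one-gate circuit `const false`. [cite: AroraBarak2009, §6.1 (descriptions of circuits)] -/
def code1 : List Bool := boolPair (boolPair (boolPair [false] []) []) [true]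

/-- The code of the two-bit shape on the wire numerals `u`, `v`: one binary AND gate. [cite: AroraBarak2009, §6.1] -/
def code2 (u v : List Bool) : List Bool :=
  boolPair (boolPair (boolPair [false, false, false, true] (boolPair (false :: u) (boolPair (false :: v) []))) []) [true]

/-- The code of the three-bit shape on the wire numerals `u`, `v`, `w`: two binary AND gates. [cite: AroraBarak2009, §6.1] -/
def code3 (u v w : List Bool) : List Bool :=
  boolPair (boolPair (boolPair [false, false, false, true] (boolPair (false :: v) (boolPair (false :: w) [])))
    (boolPair (boolPair [false, false, false, true] (boolPair (false :: u) (boolPair [true] []))) [])) [true, true]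

/-- The code of the circuit of a shape. [cite: AaronsonAmbainis2018, §6 Thm. 25] -/
def shapeCode (s : FewBits N) : List Bool := encodeCircuit s.toCircuit

/-- **The code of the constant shape.** [cite: AroraBarak2009, §6.1] -/
theorem shapeCode_one : shapeCode (FewBits.one : FewBits N) = code1 := by
  simp only [shapeCode, FewBits.toCircuit, Circuit.const, encodeCircuit, encodeGate, encodeCodeList, encodeWire,
    List.map_cons, List.map_nil, List.foldr_cons, List.foldr_nil, List.ofFn_zero, Thm25Asm.truthTable_const0,
    TokConv.encodeNat_zero', code1]

/-- **The code of a two-bit shape.** [cite: AroraBarak2009, §6.1] -/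
theorem shapeCode_two (p d : Fin N) : shapeCode (FewBits.two p d) = code2 (encodeNat p) (encodeNat d) := by
  simp only [shapeCode, FewBits.toCircuit, FewBits.and2Circuit, encodeCircuit, encodeGate, encodeCodeList, encodeWire,
    List.map_cons, List.map_nil, List.foldr_cons, List.foldr_nil, List.ofFn_succ, List.ofFn_zero,
    Matrix.cons_val_zero, Matrix.cons_val_succ, Matrix.cons_val_fin_one, Thm25Asm.truthTable_and2,
    TokConv.encodeNat_zero', code2]

/-- **The code of a three-bit shape.** [cite: AroraBarak2009, §6.1] -/
theorem shapeCode_three (a b c : Fin N) : shapeCode (FewBits.three a b c) = code3 (encodeNat a) (encodeNat b) (encodeNat c) := by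
  have h1 : encodeNat 1 = [true] := by decide
  simp only [shapeCode, FewBits.toCircuit, FewBits.and3Circuit, encodeCircuit, encodeGate, encodeCodeList, encodeWire,
    List.map_cons, List.map_nil, List.foldr_cons, List.foldr_nil, List.ofFn_succ, List.ofFn_zero,
    Matrix.cons_val_zero, Matrix.cons_val_succ, Matrix.cons_val_fin_one, Thm25Asm.truthTable_and2,
    TokConv.encodeNat_zero', h1, code3]

/-- Length of `code1`. [folklore] -/
theorem length_code1 : code1.length = 23 := rfl

/-- Length of `code2`. [folklore] -/
theorem length_code2 (u v : List Bool) : (code2 u v).length = 8 * u.length + 8 * v.length + 79 := by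
  simp only [code2, length_boolPair, List.length_cons, List.length_nil]; omega

/-- Length of `code3`. [folklore] -/
theorem length_code3 (u v w : List Bool) : (code3 u v w).length = 8 * u.length + 8 * v.length + 8 * w.length + 156 := by
  simp only [code3, length_boolPair, List.length_cons, List.length_nil]; omega

/-- The coded block of a Hadamard gate with gadget code `c`: `encList [c, c, c, code1]`. [cite: AaronsonAmbainis2018, §6 (proof of Thm. 25: the gadget, then a separating `1`)] -/
def blockH (c : List Bool) : List Bool := boolPair c (boolPair c (boolPair c (boolPair code1 [])))

/-- The coded block of a `CCSIGN` gate with phase code `c`: `encList [code1, c, code1, code1]`. [cite: AaronsonAmbainis2018, §6 (proof of Thm. 25)] -/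
def blockC (c : List Bool) : List Bool := boolPair code1 (boolPair c (boolPair code1 (boolPair code1 [])))

/-- Length of `blockH`. [folklore] -/
theorem length_blockH (c : List Bool) : (blockH c).length = 6 * c.length + 54 := by
  simp only [blockH, length_boolPair, length_code1, List.length_nil]; omega

/-- Length of `blockC`. [folklore] -/
theorem length_blockC (c : List Bool) : (blockC c).length = 2 * c.length + 146 := by
  simp only [blockC, length_boolPair, length_code1, List.length_nil]; omega


/-! ### The state of the main fold and its model -/

/-- The state of the gate-by-gate transcription: the table of wire bindings (logical qubit ↦
physical wire, chronological; the last binding counts, an unbound qubit sits on its own wire),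
the physical wire of the dummy qubit, and the output printed so far.
[cite: AaronsonAmbainis2018, §6 (proof of Thm. 25: "swapping the labels … whenever the gadget is applied")] -/
structure MSt where
  /-- the bindings `(a, w)`: logical qubit `a` moved to physical wire `w` -/
  tbl : List (ℕ × ℕ)
  /-- the physical wire of the dummy qubit -/
  dum : ℕ
  /-- the coded list of circuit codes printed so far -/
  out : List Bool

/-- The code of a state: `⟨table, ⟨bin dum, out⟩⟩`. [folklore] -/
def MSt.code (s : MSt) : List Bool := boolPair (tblCode s.tbl) (boolPair (encodeNat s.dum) s.out)

/-- All wires recorded in a state are at most `M`. [folklore] -/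
def MSt.Bounded (M : ℕ) (s : MSt) : Prop := (∀ p ∈ s.tbl, p.2 ≤ M) ∧ s.dum ≤ M

/-- **One gate of the transcription** (the model of `mainStep`): a Hadamard gate on `a` prints its
three gadget codes on the wires `pos a`, `dum` and a separator, binds `a` to the old dummy wire and
makes the old wire of `a` the dummy; a `CCSIGN` prints separator, phase code, separator,
separator; an oracle gate (absent) prints four separators.
[cite: AaronsonAmbainis2018, §6 (proof of Thm. 25)] -/
def mstep {m : ℕ} (s : MSt) : QGate hCCSign m → MSt
  | .gate HCCSignOp.H e =>
      ⟨s.tbl ++ [((hPlacement e 0 : ℕ), s.dum)], posOf s.tbl (hPlacement e 0),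
        s.out ++ blockH (code2 (encodeNat (posOf s.tbl (hPlacement e 0))) (encodeNat s.dum))⟩
  | .gate HCCSignOp.CCSIGN e =>
      ⟨s.tbl, s.dum, s.out ++ blockC (code3 (encodeNat (posOf s.tbl (ccsignPlacement e 0)))
        (encodeNat (posOf s.tbl (ccsignPlacement e 1))) (encodeNat (posOf s.tbl (ccsignPlacement e 2))))⟩
  | .oracle _ _ => ⟨s.tbl, s.dum, s.out ++ blockC code1⟩

/-- A lookup in a bounded table is bounded. [folklore] -/
theorem posOf_le {tbl : List (ℕ × ℕ)} {M a : ℕ} (h : ∀ p ∈ tbl, p.2 ≤ M) (ha : a ≤ M) : posOf tbl a ≤ M := by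
  unfold posOf
  suffices H : ∀ (l : List (ℕ × ℕ)) (acc : ℕ), (∀ p ∈ l, p.2 ≤ M) → acc ≤ M →
      l.foldl (fun acc p => if p.1 = a then p.2 else acc) acc ≤ M from H tbl a h ha
  intro l
  induction l with
  | nil => intro acc _ hacc; exact hacc
  | cons p l ih =>
    intro acc hl hacc
    rw [List.foldl_cons]
    refine ih _ (fun q hq => hl q (List.mem_cons_of_mem _ hq)) ?_
    split_ifs
    · exact hl p List.mem_cons_self
    · exact hacc

/-- One gate keeps the state bounded. [folklore] -/
theorem MSt.Bounded.mstep {M : ℕ} {s : MSt} (h : s.Bounded M) (g : QGate hCCSign M) : (Thm25Enc.mstep s g).Bounded M := by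
  rcases g with ⟨_ | _, e⟩ | ⟨k, e⟩
  · refine ⟨fun p hp => ?_, posOf_le h.1 (hPlacement e 0).is_lt.le⟩
    rcases List.mem_append.1 hp with hp | hp
    · exact h.1 p hp
    · rw [List.mem_singleton.1 hp]; exact h.2
  · exact h
  · exact h

/-! ### The main fold: one gate on codes -/

/-- On a step record `v = ⟨u, ⟨c, acc⟩⟩`: the untagged gate code `tail c = ⟨sym, ⟨1ʳ, wires⟩⟩`. [folklore] -/
def tF : List Bool → List Bool := List.tail ∘ nthF 1
/-- On a step record: the `i`-th wire numeral of the gate code. [folklore] -/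
def rF (i : ℕ) : List Bool → List Bool := nthF i ∘ sndPow 1 ∘ tF
/-- On a step record: the bit "the gate is a Hadamard gate" (empty symbol field). [folklore] -/
def isHv : List Bool → List Bool := isNilFn ∘ fstF ∘ tF
/-- On a step record: the physical wire of the `i`-th (logical) wire of the gate, looked up in the
table (field `2`), clipped to `|u| + 1` symbols. [folklore] -/
def posF (i : ℕ) : List Bool → List Bool := clipF 1 (lookupFn ∘ fanoutFn (rF i) (nthF 2))
/-- On a step record: the numeral of the dummy wire (field `3`), clipped to `|u| + 1` symbols. [folklore] -/
def dC : List Bool → List Bool := clipF 1 (nthF 3)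

/-- `⟨u, v⟩ ↦ code2 u v`. [folklore] -/
def code2Fn : List Bool → List Bool :=
  fanoutFn (fanoutFn (fanoutFn (fun _ => [false, false, false, true])
    (fanoutFn (List.cons false ∘ fstF) (fanoutFn (List.cons false ∘ sndF) (fun _ => [])))) (fun _ => [])) (fun _ => [true])

/-- `⟨u, ⟨v, w⟩⟩ ↦ code3 u v w`. [folklore] -/
def code3Fn : List Bool → List Bool :=
  fanoutFn (fanoutFn (fanoutFn (fun _ => [false, false, false, true])
      (fanoutFn (List.cons false ∘ nthF 1) (fanoutFn (List.cons false ∘ sndPow 1) (fun _ => []))))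
    (fanoutFn (fanoutFn (fun _ => [false, false, false, true]) (fanoutFn (List.cons false ∘ fstF) (fun _ => boolPair [true] [])))
      (fun _ => []))) (fun _ => [true, true])

/-- `c ↦ blockH c`. [folklore] -/
def blockHFn : List Bool → List Bool := fanoutFn id (fanoutFn id (fanoutFn id (fun _ => boolPair code1 [])))

/-- `c ↦ blockC c`. [folklore] -/
def blockCFn : List Bool → List Bool := fanoutFn (fun _ => code1) (fanoutFn id (fun _ => boolPair code1 (boolPair code1 [])))

/-- Value of `code2Fn` on every input. [folklore] -/
theorem code2Fn_eq (z : List Bool) : code2Fn z = code2 (fstF z) (sndF z) := by simp [code2Fn, code2]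

/-- Value of `code3Fn` on every input. [folklore] -/
theorem code3Fn_eq (z : List Bool) : code3Fn z = code3 (fstF z) (nthF 1 z) (sndPow 1 z) := by simp [code3Fn, code3]

/-- Value of `blockHFn`. [folklore] -/
theorem blockHFn_eq (z : List Bool) : blockHFn z = blockH z := by simp [blockHFn, blockH]

/-- Value of `blockCFn`. [folklore] -/
theorem blockCFn_eq (z : List Bool) : blockCFn z = blockC z := by simp [blockCFn, blockC]

/-- `code2Fn ∈ FP`. [folklore] -/
theorem code2Fn_mem_FP : code2Fn ∈ FP :=
  fanoutFn_mem_FP (fanoutFn_mem_FP (fanoutFn_mem_FP (const_mem_FP _) (fanoutFn_mem_FP (comp_mem_FP (cons_mem_FP false) fstF_mem_FP)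
    (fanoutFn_mem_FP (comp_mem_FP (cons_mem_FP false) sndF_mem_FP) (const_mem_FP _)))) (const_mem_FP _)) (const_mem_FP _)

/-- `code3Fn ∈ FP`. [folklore] -/
theorem code3Fn_mem_FP : code3Fn ∈ FP :=
  fanoutFn_mem_FP (fanoutFn_mem_FP
    (fanoutFn_mem_FP (const_mem_FP _) (fanoutFn_mem_FP (comp_mem_FP (cons_mem_FP false) (nthF_mem_FP 1))
      (fanoutFn_mem_FP (comp_mem_FP (cons_mem_FP false) (sndPow_mem_FP 1)) (const_mem_FP _))))
    (fanoutFn_mem_FP (fanoutFn_mem_FP (const_mem_FP _) (fanoutFn_mem_FP (comp_mem_FP (cons_mem_FP false) fstF_mem_FP) (const_mem_FP _)))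
      (const_mem_FP _))) (const_mem_FP _)

/-- `blockHFn ∈ FP`. [folklore] -/
theorem blockHFn_mem_FP : blockHFn ∈ FP :=
  fanoutFn_mem_FP (PolyTimeComputable.id _) (fanoutFn_mem_FP (PolyTimeComputable.id _) (fanoutFn_mem_FP (PolyTimeComputable.id _) (const_mem_FP _)))

/-- `blockCFn ∈ FP`. [folklore] -/
theorem blockCFn_mem_FP : blockCFn ∈ FP :=
  fanoutFn_mem_FP (const_mem_FP _) (fanoutFn_mem_FP (PolyTimeComputable.id _) (const_mem_FP _))

/-- `tF ∈ FP`. [folklore] -/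
theorem tF_mem_FP : tF ∈ FP := comp_mem_FP PRelSigma.tail_mem_FP (nthF_mem_FP 1)

/-- `rF i ∈ FP`. [folklore] -/
theorem rF_mem_FP (i : ℕ) : rF i ∈ FP := comp_mem_FP (nthF_mem_FP i) (comp_mem_FP (sndPow_mem_FP 1) tF_mem_FP)

/-- `posF i ∈ FP`. [folklore] -/
theorem posF_mem_FP (i : ℕ) : posF i ∈ FP :=
  clipF_mem_FP 1 (comp_mem_FP lookupFn_mem_FP (fanoutFn_mem_FP (rF_mem_FP i) (nthF_mem_FP 2)))

/-- `dC ∈ FP`. [folklore] -/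
theorem dC_mem_FP : dC ∈ FP := clipF_mem_FP 1 (nthF_mem_FP 3)

/-- **The step of a Hadamard gate** on `⟨u, ⟨c, ⟨T, ⟨d, out⟩⟩⟩⟩` with first wire `a`: the new state
`⟨T ++ [⟨a, d⟩], ⟨pos a, out ++ blockH (code2 (pos a) d)⟩⟩`. [cite: AaronsonAmbainis2018, §6 (proof of Thm. 25)] -/
def stepH : List Bool → List Bool :=
  fanoutFn (appF ∘ fanoutFn (nthF 2) (fanoutFn (fanoutFn (rF 0) dC) (fun _ => [])))
    (fanoutFn (posF 0) (appF ∘ fanoutFn (sndPow 3) (blockHFn ∘ code2Fn ∘ fanoutFn (posF 0) dC)))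

/-- **The step of a `CCSIGN` gate**: the table and the dummy kept, `blockC (code3 (pos a) (pos b) (pos c))`
printed. [cite: AaronsonAmbainis2018, §6 (proof of Thm. 25)] -/
def stepC : List Bool → List Bool :=
  fanoutFn (nthF 2) (fanoutFn (nthF 3) (appF ∘ fanoutFn (sndPow 3)
    (blockCFn ∘ code3Fn ∘ fanoutFn (posF 0) (fanoutFn (posF 1) (posF 2)))))

/-- **The step of the main fold**: dispatch on the symbol of the gate. [cite: AaronsonAmbainis2018, §6 (proof of Thm. 25)] -/
def mainStep : List Bool → List Bool := iteFn isHv stepH stepC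

/-- `stepH ∈ FP`. [folklore] -/
theorem stepH_mem_FP : stepH ∈ FP :=
  fanoutFn_mem_FP (comp_mem_FP appF_mem_FP (fanoutFn_mem_FP (nthF_mem_FP 2) (fanoutFn_mem_FP (fanoutFn_mem_FP (rF_mem_FP 0) dC_mem_FP) (const_mem_FP _))))
    (fanoutFn_mem_FP (posF_mem_FP 0) (comp_mem_FP appF_mem_FP (fanoutFn_mem_FP (sndPow_mem_FP 3)
      (comp_mem_FP blockHFn_mem_FP (comp_mem_FP code2Fn_mem_FP (fanoutFn_mem_FP (posF_mem_FP 0) dC_mem_FP))))))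

/-- `stepC ∈ FP`. [folklore] -/
theorem stepC_mem_FP : stepC ∈ FP :=
  fanoutFn_mem_FP (nthF_mem_FP 2) (fanoutFn_mem_FP (nthF_mem_FP 3) (comp_mem_FP appF_mem_FP (fanoutFn_mem_FP (sndPow_mem_FP 3)
    (comp_mem_FP blockCFn_mem_FP (comp_mem_FP code3Fn_mem_FP (fanoutFn_mem_FP (posF_mem_FP 0) (fanoutFn_mem_FP (posF_mem_FP 1) (posF_mem_FP 2))))))))

/-- `isHv` is one-bit. [folklore] -/
theorem oneBit_isHv : OneBit isHv := oneBit_isNilFn.comp _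

/-- **`mainStep ∈ FP`.** [cite: AroraBarak2009, §1.3] -/
theorem mainStep_mem_FP : mainStep ∈ FP :=
  iteFn_mem_FP (comp_mem_FP isNilFn_mem_FP (comp_mem_FP fstF_mem_FP tF_mem_FP)) stepH_mem_FP stepC_mem_FP

/-- Clipped positions are short: `|posF i v| ≤ |fstF v| + 1`. [folklore] -/
theorem length_posF_le (i : ℕ) (v : List Bool) : (posF i v).length ≤ (fstF v).length + 1 := by
  have := length_clipF_le 1 (lookupFn ∘ fanoutFn (rF i) (nthF 2)) v
  rw [posF]; omega

/-- The clipped dummy numeral is short: `|dC v| ≤ |fstF v| + 1`. [folklore] -/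
theorem length_dC_le (v : List Bool) : (dC v).length ≤ (fstF v).length + 1 := by
  have := length_clipF_le 1 (nthF 3) v
  rw [dC]; omega

/-- The first wire numeral is at most half the item: `2|rF 0 v| ≤ |nthF 1 v|`. [folklore] -/
theorem two_mul_length_rF_le (v : List Bool) : 2 * (rF 0 v).length ≤ (nthF 1 v).length := by
  have h1 := length_fstF_sndF_le (sndPow 1 (nthF 1 v).tail)
  have h2 := length_sndPow_le 1 (nthF 1 v).tail
  have h3 : (nthF 1 v).tail.length ≤ (nthF 1 v).length := by simp
  have e : rF 0 v = fstF (sndPow 1 (nthF 1 v).tail) := rfl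
  rw [e]; omega

/-- **Growth of the main step**: `FoldGrowth 700`. [folklore] -/
theorem foldGrowth_mainStep : FoldGrowth 700 mainStep := fun v => by
  have e1 : nthF 1 v = fstF (sndF v) := rfl
  have e2 : nthF 2 v = fstF (sndF (sndF v)) := rfl
  have e3 : nthF 3 v = fstF (sndF (sndF (sndF v))) := rfl
  have e4 : sndPow 3 v = sndF (sndF (sndF (sndF v))) := rfl
  have hA := length_fstF_sndF_le (sndF (sndF v))
  have hB := length_fstF_sndF_le (sndF (sndF (sndF v)))
  have hr := two_mul_length_rF_le v
  have hp0 := length_posF_le 0 v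
  have hp1 := length_posF_le 1 v
  have hp2 := length_posF_le 2 v
  have hd := length_dC_le v
  rw [e1] at hr
  rw [mainStep, iteFn_of_oneBit oneBit_isHv]
  split_ifs
  · simp only [stepH, fanoutFn_apply, Function.comp_apply, appF_boolPair, length_boolPair, List.length_append, List.length_nil,
      blockHFn_eq, length_blockH, code2Fn_eq, fstF_boolPair, sndF_boolPair, length_code2, e2, e4]
    omega
  · simp only [stepC, fanoutFn_apply, Function.comp_apply, appF_boolPair, length_boolPair, List.length_append,
      blockCFn_eq, length_blockC, code3Fn_eq, fstF_boolPair, nthF_succ_boolPair, nthF_zero_boolPair, sndPow_succ_boolPair,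
      sndPow_zero, sndF_boolPair, length_code3, e2, e3, e4]
    omega

/-- The initial state on `u = ⟨bin n', G⟩`: empty table, dummy on wire `n'`, nothing printed. [folklore] -/
def mainIni : List Bool → List Bool := fanoutFn (fun _ => []) (fanoutFn fstF (fun _ => []))

/-- `mainIni ∈ FP`. [folklore] -/
theorem mainIni_mem_FP : mainIni ∈ FP := fanoutFn_mem_FP (const_mem_FP _) (fanoutFn_mem_FP fstF_mem_FP (const_mem_FP _))

/-- `mainIni` on `⟨bin M, G⟩` is the code of the initial state. [folklore] -/
theorem mainIni_apply (M : ℕ) (G : List Bool) : mainIni (boolPair (encodeNat M) G) = (MSt.mk [] M []).code := by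
  simp [mainIni, MSt.code, tblCode]

/-- **`mainStep` on the code of an oracle-free gate and the code of a bounded state is the code of
the model step.** [cite: AaronsonAmbainis2018, §6 (proof of Thm. 25)] -/
theorem mainStep_encode {M : ℕ} (G : List Bool) {s : MSt} (hs : s.Bounded M) (g : QGate hCCSign M) (hg : g.IsOracleFree) :
    mainStep (boolPair (boolPair (encodeNat M) G) (boolPair g.encode s.code)) = (mstep s g).code := by
  have hclip : ∀ p : ℕ, p ≤ M → (encodeNat p).take (1 * ((boolPair (encodeNat M) G).length + 1)) = encodeNat p := fun p hp =>
    List.take_of_length_le (by have := length_encodeNat_mono hp; rw [length_boolPair]; omega)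
  rcases g with ⟨_ | _, e⟩ | ⟨k, e⟩
  · have hc : QGate.encode (QGate.gate (G := hCCSign) (n := M) HCCSignOp.H e) =
        false :: boolPair [] (listNatCode [(hPlacement e 0 : ℕ)]) := by
      rw [QGate.encode, encodingListNatBool_encode]; rfl
    rw [hc]
    set V := boolPair (boolPair (encodeNat M) G) (boolPair (false :: boolPair [] (listNatCode [(hPlacement e 0 : ℕ)])) s.code) with hV
    have et : tF V = boolPair [] (listNatCode [(hPlacement e 0 : ℕ)]) := by simp [hV, tF, nthF]
    have e2 : nthF 2 V = tblCode s.tbl := by simp [hV, nthF, MSt.code]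
    have e3 : nthF 3 V = encodeNat s.dum := by simp [hV, nthF, MSt.code]
    have e4 : sndPow 3 V = s.out := by simp [hV, sndPow, MSt.code]
    have e0 : fstF V = boolPair (encodeNat M) G := by simp [hV]
    have er : rF 0 V = encodeNat (hPlacement e 0 : ℕ) := by
      rw [rF, Function.comp_apply, Function.comp_apply, et]; simp [listNatCode, sndPow, encList_cons]
    have eH : isHv V = [true] := by rw [isHv, Function.comp_apply, Function.comp_apply, et]; simp [isNilFn]
    have ep : posF 0 V = encodeNat (posOf s.tbl (hPlacement e 0)) := by
      rw [posF, clipF_apply, e0, Function.comp_apply, fanoutFn_apply, er, e2, lookupFn_tblCode]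
      exact hclip _ (posOf_le hs.1 (hPlacement e 0).is_lt.le)
    have ed : dC V = encodeNat s.dum := by
      rw [dC, clipF_apply, e0, e3]; exact hclip _ hs.2
    rw [mainStep, iteFn_apply_true eH, stepH]
    simp only [fanoutFn_apply, Function.comp_apply, appF_boolPair, e2, e4, er, ep, ed, blockHFn_eq, code2Fn_eq, fstF_boolPair,
      sndF_boolPair]
    rw [mstep, MSt.code, tblCode_append_singleton]
    rfl
  · have hc : QGate.encode (QGate.gate (G := hCCSign) (n := M) HCCSignOp.CCSIGN e) =
        false :: boolPair [true] (listNatCode [(ccsignPlacement e 0 : ℕ), (ccsignPlacement e 1 : ℕ), (ccsignPlacement e 2 : ℕ)]) := by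
      rw [QGate.encode, encodingListNatBool_encode]; rfl
    rw [hc]
    set V := boolPair (boolPair (encodeNat M) G) (boolPair (false :: boolPair [true]
      (listNatCode [(ccsignPlacement e 0 : ℕ), (ccsignPlacement e 1 : ℕ), (ccsignPlacement e 2 : ℕ)])) s.code) with hV
    have et : tF V = boolPair [true] (listNatCode [(ccsignPlacement e 0 : ℕ), (ccsignPlacement e 1 : ℕ), (ccsignPlacement e 2 : ℕ)]) := by
      simp [hV, tF, nthF]
    have e2 : nthF 2 V = tblCode s.tbl := by simp [hV, nthF, MSt.code]
    have e3 : nthF 3 V = encodeNat s.dum := by simp [hV, nthF, MSt.code]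
    have e4 : sndPow 3 V = s.out := by simp [hV, sndPow, MSt.code]
    have e0 : fstF V = boolPair (encodeNat M) G := by simp [hV]
    have er0 : rF 0 V = encodeNat (ccsignPlacement e 0 : ℕ) := by
      rw [rF, Function.comp_apply, Function.comp_apply, et]; simp [listNatCode, sndPow, encList_cons]
    have er1 : rF 1 V = encodeNat (ccsignPlacement e 1 : ℕ) := by
      rw [rF, Function.comp_apply, Function.comp_apply, et]; simp [listNatCode, sndPow, nthF, encList_cons]
    have er2 : rF 2 V = encodeNat (ccsignPlacement e 2 : ℕ) := by
      rw [rF, Function.comp_apply, Function.comp_apply, et]; simp [listNatCode, sndPow, nthF, encList_cons]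
    have eH : isHv V = [false] := by rw [isHv, Function.comp_apply, Function.comp_apply, et]; simp [isNilFn]
    have ep : ∀ (i : ℕ) (w : Fin M), rF i V = encodeNat w → posF i V = encodeNat (posOf s.tbl w) := fun i w h => by
      rw [posF, clipF_apply, e0, Function.comp_apply, fanoutFn_apply, h, e2, lookupFn_tblCode]
      exact hclip _ (posOf_le hs.1 w.is_lt.le)
    rw [mainStep, iteFn_apply_false eH, stepC]
    simp only [fanoutFn_apply, Function.comp_apply, appF_boolPair, e2, e3, e4, ep 0 _ er0, ep 1 _ er1, ep 2 _ er2, blockCFn_eq,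
      code3Fn_eq, fstF_boolPair, nthF_succ_boolPair, nthF_zero_boolPair, sndPow_succ_boolPair, sndPow_zero, sndF_boolPair]
    rfl
  · exact absurd hg id


/-! ### The main fold on a gate list -/

/-- **The main fold on the codes of an oracle-free gate list is the model.** [cite: AaronsonAmbainis2018, §6 (proof of Thm. 25)] -/
theorem foldl_mainStep {M : ℕ} (G : List Bool) : ∀ (gl : List (QGate hCCSign M)) (s : MSt), (∀ g ∈ gl, g.IsOracleFree) →
    s.Bounded M →
      (gl.map QGate.encode).foldl (fun acc a => mainStep (boolPair (boolPair (encodeNat M) G) (boolPair a acc))) s.code =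
        (gl.foldl mstep s).code
  | [], _, _, _ => rfl
  | g :: gl, s, hgl, hs => by
    rw [List.map_cons, List.foldl_cons, List.foldl_cons, mainStep_encode G hs g (hgl g List.mem_cons_self)]
    exact foldl_mainStep G gl _ (fun g' hg' => hgl g' (List.mem_cons_of_mem _ hg')) (hs.mstep g)

/-- The translation without its final separator (cf. `forrBuildD`): per gate, its block and a
separator. [cite: AaronsonAmbainis2018, §6 (proof of Thm. 25)] -/
def forrBlocks : List (QGate hCCSign n) → WireConfig n N → List (FewBits N)
  | [], _ => []
  | g :: gs, σ => forrGateBlockD σ g ++ FewBits.one :: forrBlocks gs (forrGateStep σ g)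

/-- `forrBuildD` is `forrBlocks` followed by the final separator. [folklore] -/
theorem forrBuildD_eq_forrBlocks : ∀ (gs : List (QGate hCCSign n)) (σ : WireConfig n N),
    forrBuildD gs σ = forrBlocks gs σ ++ [FewBits.one]
  | [], _ => rfl
  | g :: gs, σ => by rw [forrBuildD, forrBlocks, forrBuildD_eq_forrBlocks gs, List.append_assoc]; rfl

/-- A state represents a wire bookkeeping: the lookups give the wires of the logical qubits and
`dum` is the wire of the dummy. [cite: AaronsonAmbainis2018, §6 (proof of Thm. 25)] -/
def MSt.Rel (σ : WireConfig n N) (s : MSt) : Prop := (∀ a : Fin n, posOf s.tbl a = (σ.pos a : ℕ)) ∧ s.dum = (σ.dum : ℕ)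

/-- The initial state represents the initial bookkeeping. [folklore] -/
theorem rel_init (m : ℕ) : (MSt.mk [] m []).Rel (WireConfig.init m) := by
  refine ⟨fun a => ?_, ?_⟩
  · change (a : ℕ) = ((finSuccEquivLast.symm (some a) : Fin (m + 1)) : ℕ)
    rw [finSuccEquivLast_symm_some]; rfl
  · change m = ((finSuccEquivLast.symm none : Fin (m + 1)) : ℕ)
    rw [finSuccEquivLast_symm_none]; rfl

/-- **One gate of the model**: the new state represents the new bookkeeping, and the printed block
is the coded block of shapes of the gate followed by the separator. [cite: AaronsonAmbainis2018, §6 (proof of Thm. 25)] -/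
theorem mstep_rel {σ : WireConfig n N} {s : MSt} (h : s.Rel σ) (g : QGate hCCSign n) :
    (mstep s g).Rel (forrGateStep σ g) ∧
      (mstep s g).out = s.out ++ encList ((forrGateBlockD σ g ++ [FewBits.one]).map shapeCode) := by
  rcases g with ⟨_ | _, e⟩ | ⟨k, e⟩
  · refine ⟨⟨fun b => ?_, ?_⟩, ?_⟩
    · change posOf (s.tbl ++ [((hPlacement e 0 : ℕ), s.dum)]) b = ((σ.hStep (hPlacement e 0)).pos b : ℕ)
      rw [posOf_append_singleton]
      by_cases hb : b = hPlacement e 0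
      · subst hb; rw [if_pos rfl, WireConfig.hStep_pos_self]; exact h.2
      · rw [if_neg (fun h' => hb (Fin.ext h').symm), WireConfig.hStep_pos_of_ne σ hb]; exact h.1 b
    · change posOf s.tbl (hPlacement e 0) = ((σ.hStep (hPlacement e 0)).dum : ℕ)
      rw [WireConfig.hStep_dum]; exact h.1 _
    · change s.out ++ blockH (code2 (encodeNat (posOf s.tbl (hPlacement e 0))) (encodeNat s.dum)) = _
      rw [h.1, h.2]
      simp only [forrGateBlockD, List.cons_append, List.nil_append, List.map_cons, List.map_nil, shapeCode_two, shapeCode_one,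
        encList_cons, encList_nil, blockH]
  · refine ⟨h, ?_⟩
    change s.out ++ blockC (code3 (encodeNat (posOf s.tbl (ccsignPlacement e 0))) (encodeNat (posOf s.tbl (ccsignPlacement e 1)))
      (encodeNat (posOf s.tbl (ccsignPlacement e 2)))) = _
    rw [h.1, h.1, h.1]
    simp only [forrGateBlockD, List.cons_append, List.nil_append, List.map_cons, List.map_nil, shapeCode_three, shapeCode_one,
      encList_cons, encList_nil, blockC]
  · refine ⟨h, ?_⟩
    change s.out ++ blockC code1 = _
    simp only [forrGateBlockD, List.cons_append, List.nil_append, List.map_cons, List.map_nil, shapeCode_one, encList_cons,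
      encList_nil, blockC]

/-- **The model prints the coded shapes of the translation.** [cite: AaronsonAmbainis2018, §6 (proof of Thm. 25)] -/
theorem foldl_mstep_out : ∀ (gl : List (QGate hCCSign n)) (σ : WireConfig n N) (s : MSt), s.Rel σ →
    (gl.foldl mstep s).out = s.out ++ encList ((forrBlocks gl σ).map shapeCode)
  | [], _, s, _ => by simp [forrBlocks]
  | g :: gl, σ, s, h => by
    obtain ⟨h1, h2⟩ := mstep_rel h g
    rw [List.foldl_cons, foldl_mstep_out gl _ _ h1, h2, forrBlocks]
    simp [List.map_append, encList_append', encList_cons, boolPair, List.append_assoc]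

/-- A branch on a computed `decide` bit is a branch on the proposition. [folklore] -/
theorem iteFn_decide {c f g : List Bool → List Bool} {z : List Bool} (p : Prop) [Decidable p] (h : c z = [decide p]) :
    iteFn c f g z = if p then f z else g z := by
  rw [iteFn_apply h]
  by_cases hp : p <;> simp [hp]

/-! ### The assembly -/

/-- On the code of an instance: the bit `[h is even]`, `h` the number of Hadamard gates. [cite: AaronsonAmbainis2018, §6 (proof of Thm. 25)] -/
def hparFn : List Bool → List Bool := parityFn ∘ lenBinF ∘ hCountFn

/-- `hparFn ∈ FP`. [folklore] -/
theorem hparFn_mem_FP : hparFn ∈ FP := comp_mem_FP parityFn_mem_FP (comp_mem_FP lenBinF_mem_FP hCountFn_mem_FP)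

/-- `hparFn` is one-bit. [folklore] -/
theorem oneBit_hparFn : OneBit hparFn := oneBit_parityFn.comp _

/-- `hparFn` on the code of an oracle-free instance. [folklore] -/
theorem hparFn_encode (I : QSimInstance) (hI : I.circuit.IsOracleFree) :
    hparFn I.encode = [decide (Even (hadamardCount I.circuit.gates))] := by
  rw [hparFn, Function.comp_apply, Function.comp_apply, hCountFn_encode I hI, lenBinF_apply, List.length_replicate, parityFn,
    bitsToNat_encodeNat]

/-- The gate list transcribed by the main fold: the compressed circuit lifted to `n'` wires,
followed (odd number of Hadamard gates) by one Hadamard gate per wire. [cite: AaronsonAmbainis2018, §6 (proof of Thm. 25)] -/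
def extGates (I : QSimInstance) : List (QGate hCCSign (nLog I)) :=
  (liftCircuitBy (I.wireCount % 2) (compress I.circuit)).gates ++
    if Even (hadamardCount I.circuit.gates) then [] else hOnAllWires (nLog I)

/-- The transcribed gates are oracle-free. [folklore] -/
theorem extGates_isOracleFree (I : QSimInstance) (hI : I.circuit.IsOracleFree) : ∀ g ∈ extGates I, g.IsOracleFree := by
  intro g hg
  rcases List.mem_append.1 hg with hg | hg
  · exact isOracleFree_liftCircuitBy _ (isOracleFree_compress hI) g hg
  · split_ifs at hg with h
    · simp at hg
    · simp only [hOnAllWires, List.mem_map] at hg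
      obtain ⟨a, -, rfl⟩ := hg
      trivial

/-- On the code of an instance: the coded gate list `G` transcribed by the main fold. [folklore] -/
def gFn : List Bool → List Bool := appF ∘ fanoutFn (cmpBodyFn ∘ fanoutFn dFn sndF) (iteFn hparFn (fun _ => []) padFn)

/-- `gFn ∈ FP`. [folklore] -/
theorem gFn_mem_FP : gFn ∈ FP :=
  comp_mem_FP appF_mem_FP (fanoutFn_mem_FP (comp_mem_FP cmpBodyFn_mem_FP (fanoutFn_mem_FP dFn_mem_FP sndF_mem_FP))
    (iteFn_mem_FP hparFn_mem_FP (const_mem_FP _) padFn_mem_FP))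

/-- **`gFn` on the code of an oracle-free instance**: the coded gate list of `extGates`. [folklore] -/
theorem gFn_encode (I : QSimInstance) (hI : I.circuit.IsOracleFree) : gFn I.encode = encList ((extGates I).map QGate.encode) := by
  have h1 : cmpBodyFn (fanoutFn dFn sndF I.encode) = encList ((liftCircuitBy (I.wireCount % 2) (compress I.circuit)).gates.map QGate.encode) := by
    rw [fanoutFn_apply, dFn_encode]
    conv_lhs => rw [QSimInstance.encode, sndF_boolPair, encode_eq_encList]
    exact cmpBodyFn_encode _ _ hI
  rw [gFn, Function.comp_apply, fanoutFn_apply, appF_boolPair, Function.comp_apply, h1, iteFn_decide _ (hparFn_encode I hI), extGates,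
    List.map_append, encList_append']
  by_cases h : Even (hadamardCount I.circuit.gates)
  · simp only [if_pos h, List.map_nil, encList_nil]
  · simp only [if_neg h, padFn_encode]

/-- On the code of an instance: the code of the final state of the main fold. [folklore] -/
def accFn : List Bool → List Bool := foldFn mainStep mainIni ∘ fanoutFn npFn gFn

/-- `accFn ∈ FP`. [cite: AroraBarak2009, §1.3 (bounded loops)] -/
theorem accFn_mem_FP : accFn ∈ FP :=
  comp_mem_FP (foldFn_mem_FP mainStep_mem_FP mainIni_mem_FP foldGrowth_mainStep) (fanoutFn_mem_FP npFn_mem_FP gFn_mem_FP)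

/-- **`accFn` on the code of an oracle-free instance** is the code of the final state of the model. [cite: AaronsonAmbainis2018, §6 (proof of Thm. 25)] -/
theorem accFn_encode (I : QSimInstance) (hI : I.circuit.IsOracleFree) :
    accFn I.encode = ((extGates I).foldl mstep ⟨[], nLog I, []⟩).code := by
  rw [accFn, Function.comp_apply, fanoutFn_apply, npFn_encode, gFn_encode I hI, foldFn_boolPair, decNil_encList, mainIni_apply]
  exact foldl_mainStep _ _ _ (extGates_isOracleFree I hI) ⟨fun p hp => by simp at hp, le_rfl⟩

/-- The list element of the separator code. [folklore] -/
def sepItem : List Bool := boolPair code1 []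

/-- On the code of an instance: the coded list of the codes of all produced circuits — the printed
blocks, the final separator, and (odd case) the separator closing the padded translation.
[cite: AaronsonAmbainis2018, §6 (proof of Thm. 25)] -/
def outFn : List Bool → List Bool :=
  appF ∘ fanoutFn (sndPow 1 ∘ accFn) (appF ∘ fanoutFn (fun _ => sepItem) (iteFn hparFn (fun _ => []) (fun _ => sepItem)))

/-- `outFn ∈ FP`. [folklore] -/
theorem outFn_mem_FP : outFn ∈ FP :=
  comp_mem_FP appF_mem_FP (fanoutFn_mem_FP (comp_mem_FP (sndPow_mem_FP 1) accFn_mem_FP)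
    (comp_mem_FP appF_mem_FP (fanoutFn_mem_FP (const_mem_FP _) (iteFn_mem_FP hparFn_mem_FP (const_mem_FP _) (const_mem_FP _)))))

/-- **`outFn` on the code of an oracle-free instance**: the coded list of the circuit codes of the
shapes `thm25Shapes`. [cite: AaronsonAmbainis2018, §6 (proof of Thm. 25)] -/
theorem outFn_encode (I : QSimInstance) (hI : I.circuit.IsOracleFree) :
    outFn I.encode = encList ((thm25Shapes I.wireCount (compress I.circuit)).map shapeCode) := by
  have hout := foldl_mstep_out (extGates I) (WireConfig.init (nLog I)) ⟨[], nLog I, []⟩ (rel_init _)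
  rw [outFn, Function.comp_apply, fanoutFn_apply, appF_boolPair, Function.comp_apply, Function.comp_apply, fanoutFn_apply,
    appF_boolPair, accFn_encode I hI, MSt.code, sndPow_succ_boolPair, sndPow_zero, sndF_boolPair, hout, List.nil_append,
    iteFn_decide _ (hparFn_encode I hI), thm25Shapes, hadamardCount_compress, extGates]
  by_cases h : Even (hadamardCount I.circuit.gates)
  · simp only [if_pos h, List.append_nil, forrBuildD_eq_forrBlocks, List.map_append, List.map_cons, List.map_nil, shapeCode_one,
      encList_append', encList_cons, encList_nil, sepItem]
  · simp only [if_neg h, forrBuildPaddedD, forrBuildD_eq_forrBlocks, List.map_append, List.map_cons, List.map_nil, shapeCode_one,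
      encList_append', encList_cons, encList_nil, sepItem, List.append_assoc]

/-- On the code of an instance: the binary numeral of the number `k` of produced circuits. [folklore] -/
def kFn : List Bool → List Bool := lenBinF ∘ countFn ∘ fanoutFn (fun _ => []) outFn

/-- `kFn ∈ FP`. [folklore] -/
theorem kFn_mem_FP : kFn ∈ FP :=
  comp_mem_FP lenBinF_mem_FP (comp_mem_FP countFn_mem_FP (fanoutFn_mem_FP (const_mem_FP _) outFn_mem_FP))

/-- `kFn` on the code of an oracle-free instance. [folklore] -/
theorem kFn_encode (I : QSimInstance) (hI : I.circuit.IsOracleFree) :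
    kFn I.encode = encodeNat (thm25Shapes I.wireCount (compress I.circuit)).length := by
  rw [kFn, Function.comp_apply, Function.comp_apply, fanoutFn_apply, outFn_encode I hI, countFn_boolPair, decNil_encList,
    List.length_map, lenBinF_apply, List.length_replicate]

/-- The oracle-freeness test: every gate code starts with the tag bit `0`. [folklore] -/
def okFn : List Bool → List Bool := allFn (notFn (HashBricks.headBitFn ∘ sndF))

/-- `okFn ∈ FP`. [folklore] -/
theorem okFn_mem_FP : okFn ∈ FP :=
  allFn_mem_FP (notFn_mem_FP (comp_mem_FP HashBricks.headBitFn_mem_FP sndF_mem_FP)) (oneBit_notFn (HashBricks.oneBit_headBitFn.comp _))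

/-- `okFn` is one-bit. [folklore] -/
theorem oneBit_okFn : OneBit okFn := oneBit_allFn (oneBit_notFn (HashBricks.oneBit_headBitFn.comp _))

/-- **Truth of `okFn` on the code of an instance**: the circuit is oracle-free. [folklore] -/
theorem okFn_encode_eq_true_iff (I : QSimInstance) : okFn I.encode = [true] ↔ I.circuit.IsOracleFree := by
  rw [okFn, QSimInstance.encode, encode_eq_encList, allFn_boolPair_eq_true (oneBit_notFn (HashBricks.oneBit_headBitFn.comp _)),
    decNil_encList]
  simp only [List.forall_mem_map]
  refine forall₂_congr fun g _ => ?_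
  rw [notFn_apply (b := (QGate.encode g).headD false) (by simp), List.cons.injEq]
  rcases g with ⟨op, e⟩ | ⟨k, e⟩
  · simp [QGate.encode, QGate.IsOracleFree]
  · simp [QGate.encode, QGate.IsOracleFree]

/-- On the code of an oracle-free instance: the code of the produced instance `⟨bin N, ⟨bin k, circuits⟩⟩`. [cite: AaronsonAmbainis2018, §6 Thm. 25] -/
def mainOutFn : List Bool → List Bool := fanoutFn nFn (fanoutFn kFn outFn)

/-- `mainOutFn ∈ FP`. [folklore] -/
theorem mainOutFn_mem_FP : mainOutFn ∈ FP := fanoutFn_mem_FP nFn_mem_FP (fanoutFn_mem_FP kFn_mem_FP outFn_mem_FP)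

/-- **The instance map of Theorem 25 on codes**: the produced instance, or the empty instance when
an oracle gate is present. [cite: AaronsonAmbainis2018, §6 Thm. 25 ("polynomial-time reducible")] -/
def encFn : List Bool → List Bool := iteFn okFn mainOutFn (fun _ => [false, true, false, true])

/-- **`encFn ∈ FP`.** [cite: AroraBarak2009, §1.3 (polynomial time is closed under composition and bounded loops)] -/
theorem encFn_mem_FP : encFn ∈ FP := iteFn_mem_FP okFn_mem_FP mainOutFn_mem_FP (const_mem_FP _)

/-- `encodeCodeList` is `encList`. [folklore] -/
theorem encodeCodeList_eq_encList : ∀ l : List (List Bool), encodeCodeList l = encList l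
  | [] => rfl
  | a :: l => by rw [encodeCodeList, List.foldr_cons, ← encodeCodeList, encodeCodeList_eq_encList l, encList_cons]

/-- The circuit codes of a list of shapes, as `KForrelationInstance.encode` lists them. [folklore] -/
theorem encodeCodeList_ofFn_get (L : List (FewBits N)) :
    encodeCodeList (List.ofFn fun i => encodeCircuit (L.get i).toCircuit) = encList (L.map shapeCode) :=
  (congrArg encodeCodeList (ofFn_get_comp L fun s => encodeCircuit s.toCircuit)).trans (encodeCodeList_eq_encList _)

/-- **`encFn` computes the code of `thm25Instance`.** [cite: AaronsonAmbainis2018, §6 Thm. 25] -/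
theorem encFn_encode (I : QSimInstance) : encFn I.encode = (thm25Instance I).encode := by
  by_cases hI : I.circuit.IsOracleFree
  · rw [encFn, iteFn_apply_true ((okFn_encode_eq_true_iff I).2 hI), mainOutFn, fanoutFn_apply, fanoutFn_apply, nFn_encode,
      kFn_encode I hI, outFn_encode I hI, thm25Instance_of_isOracleFree I hI, KForrelationInstance.encode]
    simp only
    rw [encodeCodeList_ofFn_get]
  · have hok : okFn I.encode = [false] := by
      obtain ⟨b, hb⟩ := oneBit_okFn I.encode
      cases b
      · exact hb
      · exact absurd ((okFn_encode_eq_true_iff I).1 hb) hI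
    rw [encFn, iteFn_apply_false hok, thm25Instance, if_neg hI, Thm25Asm.encode_empty]

end Thm25Enc

/-- **DISCHARGE of `AaronsonAmbainis2018_thm25_encodeFP` (the residual `TM2` content of
Aaronson–Ambainis, Theorem 25).** The instance map `thm25Instance` of Theorem 25 — compress the
touched wires, transcribe the `{H, CCSIGN}` circuit gate by gate into products of `≤ 3` input bits
with the label-swapping wire bookkeeping, parity repair, header — is computed on codes by the `FP`
string function `Thm25Enc.encFn`, assembled in the tree's algebra of polynomial-time string
functions (folds over coded lists, table lookup, branching, fan-out, bounded counted loops).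
[cite: AaronsonAmbainis2018, §6 Thm. 25 (p. 27: "polynomial-time reducible")] -/
theorem AaronsonAmbainis2018_thm25_encodeFP_holds : AaronsonAmbainis2018_thm25_encodeFP :=
  ⟨Thm25Enc.encFn, Thm25Enc.encFn_mem_FP, Thm25Enc.encFn_encode⟩

end Literature.Computability.QuantumComplexity

end
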